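import Mathlib.Topology.Spectral.ConstructibleTopology
import Literature.AlgebraicGeometry.Motives.EtaleToProetCovers
import HarnessLib

/-!
# Bhatt–Scholze Lemma 5.1.1 proved on Mathlib's carriers, without Theorem 2.3.4:
# `colim_i F(U_i) = (Lan F)(W) → (Lan F)^#(W) = ν*F(W)` is an isomorphism

`EtaleToProetLan.lean` isolates the residual content of Bhatt–Scholze Lemma 5.1.1 as the named fact
`isIso_toSheafify_lan_app_of_presentation`: for `W ∈ X_proét` with a presentation `W = lim_i U_i`
(Def. 4.2.1) and an abelian étale sheaf `F`, the sheafification map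
`(Lan F)(W) → (Lan F)^#(W) = ν*F(W)` is an isomorphism (Step A, `(Lan F)(W) = colim_i F(U_i)`, being
proved there). The printed proof (arXiv p. 29) goes through the density of pro-étale affines in
`X_proét` (Lemma 4.2.4, from Thm. 2.3.4 on the ind-étale structure of weakly étale algebras) and
the sheaf property of `Lan F` on `X_proét^aff`; `EtaleToProetDensity.lean` records that reduction.
This file **discharges the fact directly**, by an argument that stays on `X_proét` as defined
(weakly étale `X`-schemes, fpqc covers) and never needs Theorem 2.3.4:

* `isIso_toSheafify_lan_app_of_presentation_holds` — **the named fact holds**; with it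
  `nonempty_isColimit_sectionsCocone_etaleToProetPullback_holds` (**Lemma 5.1.1**,
  `ν*F(W) = colim_i F(U_i)`) and `full_faithful_etaleToProetPullback_holds` (**Lemma 5.1.2**,
  `ν*` is fully faithful) through the reductions already in the tree.

## The proof

Write `P = Lan F`, `σ : P → P^#` for the sheafification map, `E : X_ét → X_proét`.

* **Injectivity** (`ProetAffinePresentation.injective_toSheafify_lan_app`). An element of `P(W)`
  is `[s]`, `s ∈ F(U_i)` (Step A). If `σ[s] = 0`, then `[s]` dies in `P` on a pro-étale covering
  sieve `R` of `W` (local injectivity); `R` is jointly surjective, and for `f : W' → W` in `R` the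
  vanishing in the filtered colimit `P(W') = colim_{W' → V} F(V)` gives `s|_V = 0` for an étale
  `V → U_i` through which `f ≫ π_i` factors. The union `O ⊆ U_i` of their images contains the image
  of `π_i : W → U_i`, so some `U_j → U_i` lands in `O` (`W = lim U_j`, Mathlib `exists_map_eq_top`,
  Stacks 01Z2); on the open subobject `O` these `V` form an étale cover on which `s` vanishes, so
  `s|_O = 0` (`F` separated), `s|_{U_j} = 0`, `[s] = 0`.
* **Surjectivity** (`ProetAffinePresentation.surjective_toSheafify_lan_app`), for `t ∈ P^#(W)`:
  1. *Local lifts* (`exists_local_lifts_affine`): `σ` is locally surjective and `W` is affine, so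
     there are finitely many affine `V_k → W` in `X_proét`, jointly surjective, and
     `s_k ∈ P(V_k)` lifting `t|_{V_k}`; each `s_k` is `(η s'_k)|_{g_k}` for an étale `T_k`,
     `g_k : V_k → T_k` and `s'_k ∈ F(T_k)`, and one may take `T_k` affine with a map `τ_k : T_k → U_i`
     factorizing `V_k → W → U_i`.
  2. *Overlaps* (`exists_opens_forall_map_eq`): on `Q_kl = T_k ×_{U_i} T_l` there is an open `O_kl`
     on which `s'_k`, `s'_l` agree (in the sense of sieves) and which contains the image of every
     `Z → Q_kl` induced by `Z → V_k`, `Z → V_l` over `W`: the two lifts agree in `P^#(Z)`, hence in `P`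
     on a covering sieve of `Z` (local injectivity), hence in `F` on étale patches `T' → Q_kl`
     (filtered colimit, after equalizing the two maps `T' ⇉ U_i` by filteredness); `O_kl` is the
     union of the images of all agreement patches, and agreement on `O_kl` is separatedness of `F`.
  3. *Tube lemma and descent* (`exists_descended_data`): over `W`, the images `I_k` of the flat maps
     `V_k → P_k = W ×_{U_i} T_k` are intersections of their compact open neighbourhoods
     (`exists_isOpen_isCompact_range_subset_notMem`), and `p₁⁻¹(I_k) ∩ p₂⁻¹(I_l)` (the image of
     `V_k ×_W V_l`, Mathlib `Scheme.Pullback.range_map`) lies in the preimage of `O_kl` in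
     `W ×_{U_i} Q_kl`; the **tube lemma in the constructible topology**
     (`exists_isOpen_isCompact_preimage_inter_preimage_subset`, compactness of the constructible
     topology of the affine scheme `W ×_{U_i} Q_kl`, Mathlib `compactSpace_withConstructibleTopology`)
     gives compact opens `C_k ⊇ I_k` of `P_k` with `C_k ×_W C_l` mapping into `O_kl`. As
     `P_k = lim_j U_j ×_{U_i} T_k` (`nonempty_isLimit_mapCone_conePost`), the `C_k` descend to compact
     opens of some `U_j ×_{U_i} T_k` (Mathlib `exists_preimage_eq`, Stacks 01Z4), the containments
     descend (`exists_map_preimage_le_map_preimage`), and so does the joint surjectivity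
     (`exists_map_eq_top`). The final étale `X`-schemes `T'_k = U_{j₂} ×_{U_{j₁}} C_k → U_{j₂}` carry
     `V_k`, map to `T_k`, are jointly surjective over `U_{j₂}`, and the `s'_k|_{T'_k}` are compatible.
  4. *Gluing* (`exists_map_eq_of_arrows_compatible`, Mathlib `Presieve.isSheafFor_arrows_iff`) gives
     `s ∈ F(U_{j₂})`, and `σ[s] = t` because both agree on the fpqc cover `{V_k → W}` and `P^#` is
     separated (`toSheafify_lanCocone_ι_app_eq`).

## References

* B. Bhatt, P. Scholze, *The pro-étale topology for schemes*, Astérisque 369 (2015)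
  (arXiv:1309.1198, held; arXiv pages): Def. 4.1.1 (p. 23: `X_proét` = weakly étale `X`-schemes
  with fpqc covers), Def. 4.2.1 (p. 24), Lemma 5.1.1 and its proof, Lemma 5.1.2 (p. 29).
  [BhattScholze2015]
* The Stacks Project, Tags 01Z2–01Z4 (cofiltered limits of quasi-compact schemes with affine
  transition maps: nonemptiness, descent of quasi-compact opens), Mathlib `exists_map_eq_top`,
  `exists_preimage_eq`, `exists_map_preimage_le_map_preimage`. [StacksProject]

## Design notes

* Only theorems (D-0026): all intermediate objects (`W ×_{U_i} T_k`, the base-changed limit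
  cones, the final `T'_k`) are built inside proofs from Mathlib's `pullback`,
  `MorphismProperty.Over.mk` and `Over.conePost`; intermediate statements quantify over comparison
  maps by their defining equations instead of naming them.
* `rw` is unreliable on goals mentioning objects of `X.Etale`/`X.ProEt` (not type-correct at
  instances transparency) and Mathlib's `pullback.lift_fst` is not a simp lemma here; morphism
  equalities are therefore proved by explicit `Eq.trans`/`congrArg` chains or
  `simp only [pullback.lift_fst, …]`, and point-set statements are moved along morphism
  equalities with `congrArg (fun φ => φ x)`.
* Mathlib searches: `Presheaf.equalizerSieve_mem`, `Presheaf.imageSieve_mem`,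
  `Types.jointly_surjective_of_isColimit`, `Concrete.isColimit_rep_eq_iff_exists`,
  `AlgebraicGeometry.exists_map_eq_top`, `exists_preimage_eq`,
  `exists_map_preimage_le_map_preimage`, `Over.conePost`, `Over.isLimitConePost`,
  `IsOpenImmersion.lift`, `Sheaf.isSeparated`, `Presieve.isSheafFor_arrows_iff`,
  `Scheme.Pullback.exists_preimage_pullback`, `Scheme.Pullback.range_map`,
  `compactSpace_withConstructibleTopology`, `Flat.generalizingMap`, `Scheme.Hom.isOpenMap`,
  `IsCofiltered.inf_objs_exists`, `ConcreteCategory.isIso_iff_bijective`. Nothing restated.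
-/

universe u

open CategoryTheory Limits Opposite AlgebraicGeometry

noncomputable section

namespace Literature.AlgebraicGeometry.Motives

/-! ### Elements of `(Lan F)(W)` -/

section Elements

variable (X : Scheme.{u})

/-- In a filtered colimit of abelian groups every element of the colimit comes from some stage —
for index categories with objects in `Type (u+1)` and morphisms in `Type u` and values in
`Ab.{u+1}`, by transport to the equivalent small category `AsSmall K`
(Mathlib `Types.jointly_surjective_of_isColimit`). [folklore] -/
theorem exists_rep_of_isColimit_asSmall {K : Type (u + 1)} [Category.{u} K] [IsFiltered K]
    {D : K ⥤ Ab.{u + 1}} {c : Cocone D} (hc : IsColimit c) (x : c.pt) :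
    ∃ (k : K) (y : D.obj k), c.ι.app k y = x := by
  let e : AsSmall.{u + 1} K ≌ K := AsSmall.equiv.symm
  haveI : IsFiltered (AsSmall.{u + 1} K) := IsFiltered.of_equivalence e.symm
  let hc' : IsColimit (c.whisker e.functor) := hc.whiskerEquivalence e
  obtain ⟨k, y, hy⟩ := Types.jointly_surjective_of_isColimit
    (isColimitOfPreserves (forget Ab.{u + 1}) hc') x
  exact ⟨e.functor.obj k, y, hy⟩

/-- **Every element of `(Lan F)(W)` is `s|_φ` for some `φ : W → V`, `V ∈ X_ét`, `s ∈ F(V)`**: the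
image under restriction along `φ` of the image of `s` in `(Lan F)(V)` (the pointwise left Kan
extension is the filtered colimit `colim_{W → V} F(V)`). [folklore] -/
theorem exists_eq_lan_map_lanUnit (F : (X.Etale)ᵒᵖ ⥤ Ab.{u + 1}) (W : X.ProEt)
    (x : ((etaleToProet X).op.lan.obj F).obj (op W)) :
    ∃ (V : X.Etale) (φ : W ⟶ (etaleToProet X).obj V) (s : F.obj (op V)),
      x = ((etaleToProet X).op.lan.obj F).map φ.op
        (((etaleToProet X).op.lanUnit.app F).app (op V) s) := by
  obtain ⟨k, s, hs⟩ := exists_rep_of_isColimit_asSmall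
    (Functor.isPointwiseLeftKanExtensionLeftKanExtensionUnit (etaleToProet X).op F (op W)) x
  refine ⟨k.left.unop, k.hom.unop, s, ?_⟩
  rw [lan_map_lanUnit_app_apply]
  exact hs.symm

variable {X} {W : X.ProEt} (𝔭 : ProetAffinePresentation X W)

/-- Restriction along `π_i` of the image of `s ∈ F(U_i)` in `(Lan F)(U_i)` is the leg of Step A's
cocone at `i` (by `rfl`). [folklore] -/
theorem ProetAffinePresentation.lan_map_π_lanUnit_apply (F : (X.Etale)ᵒᵖ ⥤ Ab.{u + 1}) (i : 𝔭.ι)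
    (s : F.obj (op (𝔭.diagram.obj i))) :
    ((etaleToProet X).op.lan.obj F).map (𝔭.π.app i).op
        (((etaleToProet X).op.lanUnit.app F).app (op (𝔭.diagram.obj i)) s) =
      (𝔭.lanCocone F).ι.app (op i) s :=
  rfl

/-- **Every element of `(Lan F)(W)` is the class `[s]` of some `s ∈ F(U_i)`** (`W = lim_i U_i`):
write it as `s'|_φ` for `φ : W → V` (`exists_eq_lan_map_lanUnit`), factor `φ = π_i ≫ g` through
some `U_i` (`ProetAffinePresentation.exists_fac`, Stacks 01ZC) and take `s = s'|_g`.
[cite: BhattScholze2015, Lemma 5.1.1 (proof)] -/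
theorem ProetAffinePresentation.exists_eq_lanCocone_ι_app (F : (X.Etale)ᵒᵖ ⥤ Ab.{u + 1})
    (x : ((etaleToProet X).op.lan.obj F).obj (op W)) :
    ∃ (i : 𝔭.ι) (s : F.obj (op (𝔭.diagram.obj i))), x = (𝔭.lanCocone F).ι.app (op i) s := by
  obtain ⟨V, φ, s, rfl⟩ := exists_eq_lan_map_lanUnit X F W x
  obtain ⟨i, g, hg⟩ := 𝔭.exists_fac V φ
  refine ⟨i, F.map g.op s, ?_⟩
  have hnat : ((etaleToProet X).op.lanUnit.app F).app (op (𝔭.diagram.obj i)) (F.map g.op s) =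
      ((etaleToProet X).op.lan.obj F).map ((etaleToProet X).map g).op
        (((etaleToProet X).op.lanUnit.app F).app (op V) s) :=
    NatTrans.naturality_apply ((etaleToProet X).op.lanUnit.app F) g.op s
  refine Eq.trans ?_ (𝔭.lan_map_π_lanUnit_apply F i (F.map g.op s))
  refine Eq.trans ?_ (congrArg (((etaleToProet X).op.lan.obj F).map (𝔭.π.app i).op) hnat).symm
  refine Eq.trans (congrArg (fun ψ => ((etaleToProet X).op.lan.obj F).map ψ.op
    (((etaleToProet X).op.lanUnit.app F).app (op V) s)) hg).symm ?_
  exact ConcreteCategory.congr_hom (((etaleToProet X).op.lan.obj F).map_comp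
    ((etaleToProet X).map g).op (𝔭.π.app i).op) _

end Elements

/-! ### Open subobjects of `X_ét`: morphisms landing in an open factor through it -/

section OpenSubobject

variable {X : Scheme.{u}}

/-- A morphism `g : V → U` of `X_ét` whose image lies in the open `O ⊆ U` factors through the
open subobject `O` (`etOfOpens U O`, Mathlib `IsOpenImmersion.lift`). [folklore] -/
theorem exists_comp_etOfOpensι_eq (U : X.Etale) (O : U.left.Opens) {V : X.Etale} (g : V ⟶ U)
    (h : Set.range g.left ⊆ (O : Set U.left)) :
    ∃ g' : V ⟶ etOfOpens U O, g' ≫ etOfOpensι U O = g :=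
  ⟨MorphismProperty.Over.homMk
    (IsOpenImmersion.lift O.ι g.left (h.trans (Scheme.Opens.range_ι O).symm.subset) :
      V.left ⟶ (O : Scheme.{u}))
    (((Category.assoc _ _ _).symm.trans (congrArg (· ≫ U.hom)
      (IsOpenImmersion.lift_fac O.ι g.left
        (h.trans (Scheme.Opens.range_ι O).symm.subset)))).trans
      (Over.w ((Scheme.Etale.forget X).map g))),
    MorphismProperty.Over.Hom.ext (IsOpenImmersion.lift_fac O.ι g.left _)⟩

/-- On points, a factorization `g = g' ≫ (O ↪ U)` reads `g(v) = g'(v)`. [folklore] -/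
theorem ι_apply_of_comp_etOfOpensι_eq (U : X.Etale) (O : U.left.Opens) {V : X.Etale} {g : V ⟶ U}
    {g' : V ⟶ etOfOpens U O} (hg' : g' ≫ etOfOpensι U O = g) (v : V.left) :
    O.ι (g'.left v) = g.left v :=
  congrArg (fun k : V ⟶ U => k.left v) hg'

end OpenSubobject

/-! ### The injectivity half of Lemma 5.1.1 -/

section Injective

variable {X : Scheme.{u}} {W : X.ProEt}

/-- **If `[s] ∈ (Lan F)(W)` (`s ∈ F(U_i)`) dies in `ν*F(W) = (Lan F)^#(W)`, then `[s] = 0`.**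
See the module docstring for the proof. [cite: BhattScholze2015, Lemma 5.1.1] -/
theorem ProetAffinePresentation.lanCocone_ι_app_eq_zero (𝔭 : ProetAffinePresentation X W)
    (F : Sheaf X.smallEtaleTopology Ab.{u + 1}) (i : 𝔭.ι) (s : F.obj.obj (op (𝔭.diagram.obj i)))
    (hs : (toSheafify (Scheme.ProEt.topology X) ((etaleToProet X).op.lan.obj F.obj)).app (op W)
      ((𝔭.lanCocone F.obj).ι.app (op i) s) = 0) :
    (𝔭.lanCocone F.obj).ι.app (op i) s = 0 := by
  -- notation
  let P := (etaleToProet X).op.lan.obj F.obj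
  let Uᵢ : X.Etale := 𝔭.diagram.obj i
  -- `[s]` vanishes on a covering sieve `R` of `W`
  have hR := Presheaf.equalizerSieve_mem (Scheme.ProEt.topology X)
    (toSheafify (Scheme.ProEt.topology X) P) ((𝔭.lanCocone F.obj).ι.app (op i) s) 0
    (hs.trans (map_zero _).symm)
  -- the sieve of étale maps `g : V → U_i` with `s|_V = 0`
  let T : Sieve Uᵢ :=
    { arrows := fun V g => F.obj.map g.op s = 0
      downward_closed := by
        intro V V' g hg k
        rw [op_comp, F.obj.map_comp]
        change F.obj.map k.op (F.obj.map g.op s) = 0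
        rw [hg, map_zero] }
  -- the union of their images
  let O : Uᵢ.left.Opens :=
    ⨆ q : Σ V : X.Etale, {g : V ⟶ Uᵢ // T g},
      ⟨Set.range q.2.1.left, q.2.1.left.isOpenMap.isOpen_range⟩
  have hTO : ∀ ⦃V : X.Etale⦄ (g : V ⟶ Uᵢ), T g → Set.range g.left ⊆ (O : Set Uᵢ.left) := by
    intro V g hg y hy
    refine TopologicalSpace.Opens.mem_iSup.2 ⟨⟨V, g, hg⟩, ?_⟩
    exact hy
  -- `O` contains the image of `π_i : W → U_i`
  have hO : ∀ w : W.left, (𝔭.π.app i).left w ∈ O := by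
    intro w
    obtain ⟨W', f, hf, w', rfl⟩ := exists_mem_of_mem_proEtTopology hR w
    -- `[s]|_f = 0` in the filtered colimit `(Lan F)(W') = colim_{W' → V} F(V)`
    have h1 : P.map f.op ((𝔭.lanCocone F.obj).ι.app (op i) s) = 0 :=
      (Eq.trans hf (map_zero _))
    have h2 : P.map (f ≫ 𝔭.π.app i).op
        (((etaleToProet X).op.lanUnit.app F.obj).app (op Uᵢ) s) = 0 := by
      rw [op_comp, P.map_comp, ConcreteCategory.comp_apply]
      exact h1
    have h0 : ((Functor.LeftExtension.mk _
        ((etaleToProet X).op.leftKanExtensionUnit F.obj)).coconeAt (op W')).ι.app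
          (CostructuredArrow.mk (f ≫ 𝔭.π.app i).op) s = 0 :=
      (lan_map_lanUnit_app_apply X F.obj (f ≫ 𝔭.π.app i) s).symm.trans h2
    obtain ⟨k, α, hα⟩ := exists_map_eq_zero_of_isColimit
      (j := CostructuredArrow.mk (f ≫ 𝔭.π.app i).op)
      (Functor.isPointwiseLeftKanExtensionLeftKanExtensionUnit (etaleToProet X).op F.obj (op W'))
      s h0
    have hw := CostructuredArrow.w α
    have hmem : T α.left.unop := hα
    apply hTO α.left.unop hmem
    refine ⟨k.hom.unop.left w', ?_⟩
    exact congrArg (fun φ => φ.unop.left w') hw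
  -- some `U_j → U_i` lands in `O` (the limit argument)
  let D : 𝔭.ι ⥤ Scheme.{u} := (𝔭.diagram ⋙ Scheme.Etale.forget X) ⋙ Over.forget X
  let c : Cone D := (Over.forget X).mapCone 𝔭.overCone
  have hc : IsLimit c := isLimitOfPreserves (Over.forget X) 𝔭.isLimitOverCone
  haveI : ∀ {j j' : 𝔭.ι} (a : j ⟶ j'), IsAffineHom (D.map a) := fun a =>
    inferInstanceAs (IsAffineHom (𝔭.diagram.map a).left)
  haveI : ∀ j : 𝔭.ι, CompactSpace (D.obj j) := fun j =>
    inferInstanceAs (CompactSpace (𝔭.diagram.obj j).left)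
  have hU : c.π.app i ⁻¹ᵁ O = ⊤ := by
    refine top_le_iff.1 fun w _ => ?_
    exact hO w
  obtain ⟨j, a, hja⟩ := exists_map_eq_top D c hc O hU
  -- `s` vanishes on the open subobject `O` of `U_i`
  let Oₑ : X.Etale := etOfOpens Uᵢ O
  let ι : Oₑ ⟶ Uᵢ := etOfOpensι Uᵢ O
  have hcov : T.pullback ι ∈ X.smallEtaleTopology Oₑ := by
    refine mem_smallEtaleTopology_of_exists _ fun o => ?_
    obtain ⟨q, hq⟩ := TopologicalSpace.Opens.mem_iSup.1 o.2
    obtain ⟨v, hv⟩ := hq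
    obtain ⟨g', hg'⟩ := exists_comp_etOfOpensι_eq Uᵢ O q.2.1 (hTO q.2.1 q.2.2)
    refine ⟨q.1, g', ?_, v, ?_⟩
    · change T (g' ≫ etOfOpensι Uᵢ O)
      rw [hg']
      exact q.2.2
    · apply Subtype.ext
      exact (ι_apply_of_comp_etOfOpensι_eq Uᵢ O hg' v).trans hv
  have hsO : F.obj.map ι.op s = 0 :=
    (Sheaf.isSeparated F) Oₑ (T.pullback ι) hcov (F.obj.map ι.op s) 0 (fun V g hg => by
      rw [map_zero, ← ConcreteCategory.comp_apply, ← F.obj.map_comp, ← op_comp]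
      exact hg)
  -- hence on `U_j`
  have hrange : Set.range (𝔭.diagram.map a).left ⊆ (O : Set Uᵢ.left) := by
    rintro _ ⟨y, rfl⟩
    have : y ∈ (D.map a ⁻¹ᵁ O) := by
      rw [hja]
      trivial
    exact this
  have hsj : F.obj.map (𝔭.diagram.map a).op s = 0 := by
    obtain ⟨u', hu'⟩ := exists_comp_etOfOpensι_eq Uᵢ O (𝔭.diagram.map a) hrange
    rw [← hu', op_comp, F.obj.map_comp, ConcreteCategory.comp_apply]
    change F.obj.map u'.op (F.obj.map ι.op s) = 0
    rw [hsO, map_zero]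
  -- and `[s] = [s|_{U_j}] = 0`
  have hw := (𝔭.lanCocone F.obj).w (a.op : op i ⟶ op j)
  have h3 : ((𝔭.diagram.op ⋙ F.obj).map a.op ≫ (𝔭.lanCocone F.obj).ι.app (op j)) s = 0 := by
    change (𝔭.lanCocone F.obj).ι.app (op j) (F.obj.map (𝔭.diagram.map a).op s) = 0
    rw [hsj, map_zero]
  exact (ConcreteCategory.congr_hom hw s).symm.trans h3

/-- **The injectivity half of Bhatt–Scholze Lemma 5.1.1, proved unconditionally: for a pro-étale
affine `W = lim_i U_i` and an abelian étale sheaf `F`, the sheafification map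
`(Lan F)(W) → (Lan F)^#(W) = ν*F(W)` is injective** — i.e. `colim_i F(U_i) → ν*F(W)` is a
monomorphism (no use of Lemma 4.2.4 / Thm. 2.3.4). [cite: BhattScholze2015, Lemma 5.1.1] -/
theorem ProetAffinePresentation.injective_toSheafify_lan_app (𝔭 : ProetAffinePresentation X W)
    (F : Sheaf X.smallEtaleTopology Ab.{u + 1}) :
    Function.Injective ((toSheafify (Scheme.ProEt.topology X)
      ((etaleToProet X).op.lan.obj F.obj)).app (op W)) := by
  refine (injective_iff_map_eq_zero _).2 fun x hx => ?_
  obtain ⟨i, s, rfl⟩ := 𝔭.exists_eq_lanCocone_ι_app F.obj x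
  exact 𝔭.lanCocone_ι_app_eq_zero F i s hx

/-- The sheafification map `(Lan F)(W) → ν*F(W)` is a monomorphism at every pro-étale affine `W`.
[cite: BhattScholze2015, Lemma 5.1.1] -/
theorem ProetAffinePresentation.mono_toSheafify_lan_app (𝔭 : ProetAffinePresentation X W)
    (F : Sheaf X.smallEtaleTopology Ab.{u + 1}) :
    Mono ((toSheafify (Scheme.ProEt.topology X) ((etaleToProet X).op.lan.obj F.obj)).app (op W)) :=
  ConcreteCategory.mono_of_injective _ (𝔭.injective_toSheafify_lan_app F)

/-- **`θ_W : (Lan F)(W) → ν*F(W)` is injective** (`lanToPullbackApp`: the sheafification map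
followed by the isomorphism `(Lan –)^# ≅ ν*`), i.e. the comparison map
`colim_i F(U_i) → ν*F(W)` of Lemma 5.1.1, through which the sections cocone factors
(`ProetAffinePresentation.sectionsCocone_ι_app_eq`), is injective. [cite: BhattScholze2015, Lemma 5.1.1] -/
theorem ProetAffinePresentation.injective_lanToPullbackApp (𝔭 : ProetAffinePresentation X W)
    (F : Sheaf X.smallEtaleTopology Ab.{u + 1}) : Function.Injective (lanToPullbackApp X F W) := by
  haveI := isIso_etaleToProetPullbackIso_inv_app_hom_app X F (op W)
  have h₂ := (ConcreteCategory.bijective_of_isIso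
    (((etaleToProetPullbackIso X).inv.app F).hom.app (op W))).1
  intro a b h
  exact 𝔭.injective_toSheafify_lan_app F (h₂ h)

/-- `θ_W` is a monomorphism. [cite: BhattScholze2015, Lemma 5.1.1] -/
theorem ProetAffinePresentation.mono_lanToPullbackApp (𝔭 : ProetAffinePresentation X W)
    (F : Sheaf X.smallEtaleTopology Ab.{u + 1}) : Mono (lanToPullbackApp X F W) :=
  ConcreteCategory.mono_of_injective _ (𝔭.injective_lanToPullbackApp F)

/-- The injectivity of Lemma 5.1.1 for all presentations at once, in the shape of the named fact
`isIso_toSheafify_lan_app_of_presentation` with `IsIso` weakened to `Mono`.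
[cite: BhattScholze2015, Lemma 5.1.1] -/
theorem mono_toSheafify_lan_app_of_presentation (X' : Scheme.{u}) (W' : X'.ProEt)
    (𝔭 : ProetAffinePresentation X' W') (F : Sheaf X'.smallEtaleTopology Ab.{u + 1}) :
    Mono ((toSheafify (Scheme.ProEt.topology X') ((etaleToProet X').op.lan.obj F.obj)).app
      (op W')) :=
  𝔭.mono_toSheafify_lan_app F

end Injective

/-! ## The surjectivity half: tube lemma, base change of the presentation, local lifts,
agreement on overlaps, descent, gluing -/

/-! ### A tube lemma in the constructible topology, and images of flat morphisms -/
section Tube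

open _root_.Topology Set

variable {Q P₁ P₂ : Type*} [TopologicalSpace Q] [TopologicalSpace P₁] [TopologicalSpace P₂]

/-- In a quasi-separated compact space, a finite intersection of compact open sets is compact
open. [folklore] -/
theorem isOpen_isCompact_biInter_finset [CompactSpace P₁] [QuasiSeparatedSpace P₁] {ι : Type*}
    (c : ι → Set P₁) (hc : ∀ i, IsOpen (c i) ∧ IsCompact (c i)) (u : Finset ι) :
    IsOpen (⋂ i ∈ u, c i) ∧ IsCompact (⋂ i ∈ u, c i) := by
  classical
  induction u using Finset.induction_on with
  | empty => simpa using isCompact_univ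
  | insert a u ha ih =>
    rw [Finset.set_biInter_insert]
    exact ⟨(hc a).1.inter ih.1, QuasiSeparatedSpace.inter_isCompact _ _ (hc a).1 (hc a).2 ih.1 ih.2⟩

/-- **Tube lemma in the constructible topology.** Let `Q` be a spectral space (e.g. a qcqs
scheme), `p₁ : Q → P₁`, `p₂ : Q → P₂` continuous maps under which preimages of compact opens are
compact, `I₁ ⊆ P₁`, `I₂ ⊆ P₂` subsets which are the intersection of their compact open
neighbourhoods, and `O ⊆ Q` an open set containing `p₁⁻¹(I₁) ∩ p₂⁻¹(I₂)`. Then there are compact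
open neighbourhoods `C₁ ⊇ I₁`, `C₂ ⊇ I₂` with `p₁⁻¹(C₁) ∩ p₂⁻¹(C₂) ⊆ O`: the sets
`p₁⁻¹(C) ∩ p₂⁻¹(C') ∖ O` are closed in the (compact) constructible topology of `Q` and have empty
intersection, so finitely many of them already do. [folklore] -/
theorem exists_isOpen_isCompact_preimage_inter_preimage_subset
    [CompactSpace Q] [QuasiSober Q] [PrespectralSpace Q] [QuasiSeparatedSpace Q]
    [CompactSpace P₁] [QuasiSeparatedSpace P₁] [CompactSpace P₂] [QuasiSeparatedSpace P₂]
    {p₁ : Q → P₁} {p₂ : Q → P₂} (hp₁ : Continuous p₁) (hp₂ : Continuous p₂)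
    (hq₁ : ∀ ⦃U : Set P₁⦄, IsOpen U → IsCompact U → IsCompact (p₁ ⁻¹' U))
    (hq₂ : ∀ ⦃U : Set P₂⦄, IsOpen U → IsCompact U → IsCompact (p₂ ⁻¹' U))
    (I₁ : Set P₁) (I₂ : Set P₂)
    (hI₁ : ∀ x ∉ I₁, ∃ U : Set P₁, IsOpen U ∧ IsCompact U ∧ I₁ ⊆ U ∧ x ∉ U)
    (hI₂ : ∀ x ∉ I₂, ∃ U : Set P₂, IsOpen U ∧ IsCompact U ∧ I₂ ⊆ U ∧ x ∉ U)
    {O : Set Q} (hO : IsOpen O) (H : p₁ ⁻¹' I₁ ∩ p₂ ⁻¹' I₂ ⊆ O) :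
    ∃ (C₁ : Set P₁) (C₂ : Set P₂), (IsOpen C₁ ∧ IsCompact C₁) ∧ I₁ ⊆ C₁ ∧
      (IsOpen C₂ ∧ IsCompact C₂) ∧ I₂ ⊆ C₂ ∧ p₁ ⁻¹' C₁ ∩ p₂ ⁻¹' C₂ ⊆ O := by
  classical
  -- the index types of compact open neighbourhoods of `I₁`, `I₂`
  let κ₁ := {U : Set P₁ // IsOpen U ∧ IsCompact U ∧ I₁ ⊆ U}
  let κ₂ := {U : Set P₂ // IsOpen U ∧ IsCompact U ∧ I₂ ⊆ U}
  let c₁ : κ₁ ⊕ κ₂ → Set P₁ := fun i => Sum.elim (fun U => U.1) (fun _ => univ) i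
  let c₂ : κ₁ ⊕ κ₂ → Set P₂ := fun i => Sum.elim (fun _ => univ) (fun U => U.1) i
  have hc₁ : ∀ i, IsOpen (c₁ i) ∧ IsCompact (c₁ i) := by
    rintro (U | U)
    · exact ⟨U.2.1, U.2.2.1⟩
    · exact ⟨isOpen_univ, isCompact_univ⟩
  have hc₂ : ∀ i, IsOpen (c₂ i) ∧ IsCompact (c₂ i) := by
    rintro (U | U)
    · exact ⟨isOpen_univ, isCompact_univ⟩
    · exact ⟨U.2.1, U.2.2.1⟩
  have hIc₁ : ∀ i, I₁ ⊆ c₁ i := by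
    rintro (U | U)
    · exact U.2.2.2
    · exact subset_univ _
  have hIc₂ : ∀ i, I₂ ⊆ c₂ i := by
    rintro (U | U)
    · exact subset_univ _
    · exact U.2.2.2
  let t : κ₁ ⊕ κ₂ → Set Q := fun i => p₁ ⁻¹' c₁ i ∩ p₂ ⁻¹' c₂ i
  have ht : ∀ i, IsOpen (t i) ∧ IsCompact (t i) := fun i =>
    ⟨((hc₁ i).1.preimage hp₁).inter ((hc₂ i).1.preimage hp₂),
      QuasiSeparatedSpace.inter_isCompact _ _ ((hc₁ i).1.preimage hp₁) (hq₁ (hc₁ i).1 (hc₁ i).2)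
        ((hc₂ i).1.preimage hp₂) (hq₂ (hc₂ i).1 (hc₂ i).2)⟩
  -- the total intersection misses `Oᶜ`
  have hempty : Oᶜ ∩ ⋂ i, t i = ∅ := by
    refine Set.eq_empty_iff_forall_notMem.2 fun q hq => ?_
    have hq' := Set.mem_iInter.1 hq.2
    have h₁ : p₁ q ∈ I₁ := by
      by_contra h
      obtain ⟨U, hUo, hUc, hIU, hqU⟩ := hI₁ _ h
      exact hqU (hq' (Sum.inl ⟨U, hUo, hUc, hIU⟩)).1
    have h₂ : p₂ q ∈ I₂ := by
      by_contra h
      obtain ⟨U, hUo, hUc, hIU, hqU⟩ := hI₂ _ h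
      exact hqU (hq' (Sum.inr ⟨U, hUo, hUc, hIU⟩)).2
    exact hq.1 (H ⟨h₁, h₂⟩)
  -- compactness of the constructible topology
  have hQ : @IsCompact Q (constructibleTopology Q) (univ : Set Q) := by
    haveI : CompactSpace (WithConstructibleTopology Q) :=
      compactSpace_withConstructibleTopology (X := Q)
    have := @IsCompact.image _ _ _ (constructibleTopology Q) _ _
      (@isCompact_univ (WithConstructibleTopology Q) _ _)
      (WithTopology.continuous_ofTopology (constructibleTopology Q))
    rwa [image_univ, (WithTopology.ofTopology_surjective (constructibleTopology Q)).range_eq]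
      at this
  have hopen : ∀ {s : Set Q}, IsOpen s → IsCompact s → IsClosed[constructibleTopology Q] s := by
    intro s hs hs'
    rw [← @isOpen_compl_iff]
    exact IsCompact.isOpen_constructibleTopology_of_isClosed (by rwa [compl_compl])
      (by rwa [isClosed_compl_iff])
  have hOτ : IsClosed[constructibleTopology Q] Oᶜ := by
    rw [← @isOpen_compl_iff, compl_compl]
    obtain ⟨S, hSB, hOS⟩ := PrespectralSpace.isTopologicalBasis.open_eq_sUnion hO
    rw [hOS]
    exact @isOpen_sUnion Q (constructibleTopology Q) _ fun s hs =>
      IsCompact.isOpen_constructibleTopology_of_isOpen (hSB hs).2 (hSB hs).1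
  have hOc : @IsCompact Q (constructibleTopology Q) Oᶜ :=
    @IsCompact.of_isClosed_subset Q (constructibleTopology Q) _ _ hQ hOτ (subset_univ _)
  obtain ⟨u, hu⟩ := @IsCompact.elim_finite_subfamily_closed Q (constructibleTopology Q) _ _ hOc t
    (fun i => hopen (ht i).1 (ht i).2) hempty
  -- the finite intersections do it
  refine ⟨⋂ i ∈ u, c₁ i, ⋂ i ∈ u, c₂ i, isOpen_isCompact_biInter_finset c₁ hc₁ u,
    subset_iInter₂ fun i _ => hIc₁ i, isOpen_isCompact_biInter_finset c₂ hc₂ u,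
    subset_iInter₂ fun i _ => hIc₂ i, fun q hq => ?_⟩
  by_contra hqO
  have : q ∈ Oᶜ ∩ ⋂ i ∈ u, t i := by
    refine ⟨hqO, mem_iInter₂.2 fun i hi => ⟨?_, ?_⟩⟩
    · exact (mem_iInter₂.1 hq.1) i hi
    · exact (mem_iInter₂.1 hq.2) i hi
  rw [hu] at this
  exact this

end Tube

section Flat

open Set

/-- **The image of a flat morphism from a quasi-compact scheme is the intersection of its compact
open neighbourhoods**: for `x` outside the image there is a compact open containing the image and
not `x`. (The image is stable under generalization, so it misses the closure of `x`; cover the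
compact source by preimages of compact opens avoiding that closure.) [folklore] -/
theorem exists_isOpen_isCompact_range_subset_notMem {V P : Scheme.{u}} (f : V ⟶ P) [Flat f]
    [CompactSpace V] (x : P) (hx : x ∉ Set.range f) :
    ∃ U : Set P, IsOpen U ∧ IsCompact U ∧ Set.range f ⊆ U ∧ x ∉ U := by
  classical
  have hstab := (Flat.generalizingMap f).stableUnderGeneralization_range
  have h1 : ∀ v : V, f v ∈ (closure {x})ᶜ := by
    intro v hv
    exact hx (hstab (specializes_iff_mem_closure.2 hv) (mem_range_self v))
  have h2 : ∀ v : V, ∃ B : Set P, (IsOpen B ∧ IsCompact B) ∧ f v ∈ B ∧ B ⊆ (closure {x})ᶜ :=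
    fun v => PrespectralSpace.isTopologicalBasis.exists_subset_of_mem_open (h1 v)
      isClosed_closure.isOpen_compl
  choose B hB hvB hBx using h2
  obtain ⟨σ, hσ⟩ := isCompact_univ.elim_finite_subcover (fun v => f ⁻¹' B v)
    (fun v => (hB v).1.preimage f.continuous) fun v _ => mem_iUnion.2 ⟨v, hvB v⟩
  refine ⟨⋃ v ∈ σ, B v, isOpen_biUnion fun v _ => (hB v).1,
    σ.finite_toSet.isCompact_biUnion fun v _ => (hB v).2, ?_, fun hxU => ?_⟩
  · rintro _ ⟨v, rfl⟩
    have := hσ (mem_univ v)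
    simp only [mem_iUnion, mem_preimage] at this
    obtain ⟨w, hw, hvw⟩ := this
    exact mem_biUnion hw hvw
  · simp only [mem_iUnion] at hxU
    obtain ⟨v, -, hxv⟩ := hxU
    exact hBx v hxv (subset_closure (mem_singleton x))

end Flat

/-! ### Base change of a cofiltered limit of schemes -/
section BaseChange

variable {I : Type u} [Category.{u} I] (D : I ⥤ Scheme.{u}) (c : Cone D) (i : I) {Y : Scheme.{u}}
  (y : Y ⟶ D.obj i)

/-- **Base change of a cofiltered limit of schemes**: if `c` is a limit cone of `D : I ⥤ Scheme`
(cofiltered) and `y : Y → D i`, then `c.pt ×_{D i} Y` is the limit of `j ↦ D j ×_{D i} Y` over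
`j → i` (the functor `Over.pullback y` is a right adjoint, `Over.forget` preserves connected limits,
Mathlib `Over.isLimitConePost`). [folklore] -/
theorem nonempty_isLimit_mapCone_conePost [IsCofiltered I] (hc : IsLimit c) :
    Nonempty (IsLimit ((Over.pullback y ⋙ Over.forget Y).mapCone ((Over.conePost D i).obj c))) := by
  haveI : IsConnected (Over i) := IsCofiltered.isConnected _
  haveI : PreservesLimitsOfSize.{u, u} (Over.pullback y) :=
    (Over.mapPullbackAdj y).rightAdjoint_preservesLimits
  exact ⟨isLimitOfPreserves (Over.pullback y ⋙ Over.forget Y) (Over.isLimitConePost i hc)⟩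

/-- The objects of the base-changed diagram (by `rfl`). [folklore] -/
theorem post_pullback_forget_obj (j : Over i) :
    (Over.post D ⋙ Over.pullback y ⋙ Over.forget Y).obj j = pullback (D.map j.hom) y :=
  rfl

/-- The transition maps of the base-changed diagram commute with the first projections.
[folklore] -/
theorem post_pullback_forget_map_fst {j j' : Over i} (k : j ⟶ j') :
    (Over.post D ⋙ Over.pullback y ⋙ Over.forget Y).map k ≫ pullback.fst _ _ =
      pullback.fst _ _ ≫ D.map k.left :=
  pullback.lift_fst _ _ _

/-- The transition maps of the base-changed diagram commute with the second projections.
[folklore] -/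
theorem post_pullback_forget_map_snd {j j' : Over i} (k : j ⟶ j') :
    (Over.post D ⋙ Over.pullback y ⋙ Over.forget Y).map k ≫ pullback.snd _ _ =
      pullback.snd _ _ :=
  pullback.lift_snd _ _ _

/-- The apex of the base-changed cone (by `rfl`). [folklore] -/
theorem mapCone_conePost_pt :
    ((Over.pullback y ⋙ Over.forget Y).mapCone ((Over.conePost D i).obj c)).pt =
      pullback (c.π.app i) y :=
  rfl

/-- The projections of the base-changed cone commute with the first projections. [folklore] -/
theorem mapCone_conePost_π_app_fst (j : Over i) :
    ((Over.pullback y ⋙ Over.forget Y).mapCone ((Over.conePost D i).obj c)).π.app j ≫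
        pullback.fst _ _ = pullback.fst _ _ ≫ c.π.app j.left :=
  pullback.lift_fst _ _ _

/-- The projections of the base-changed cone commute with the second projections. [folklore] -/
theorem mapCone_conePost_π_app_snd (j : Over i) :
    ((Over.pullback y ⋙ Over.forget Y).mapCone ((Over.conePost D i).obj c)).π.app j ≫
        pullback.snd _ _ = pullback.snd _ _ :=
  pullback.lift_snd _ _ _

end BaseChange

/-! ### More on elements of filtered colimits and open subobjects -/

section General

variable (X : Scheme.{u})

/-- In a filtered colimit of abelian groups two elements with the same image in the colimit
become equal at some common stage (index categories with objects in `Type (u+1)`, morphisms in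
`Type u`, values in `Ab.{u+1}`; transport to `AsSmall`, Mathlib
`Concrete.isColimit_rep_eq_iff_exists`). [folklore] -/
theorem exists_map_eq_map_of_isColimit_asSmall {K : Type (u + 1)} [Category.{u} K] [IsFiltered K]
    {D : K ⥤ Ab.{u + 1}} {c : Cocone D} (hc : IsColimit c) {j j' : K} (x : D.obj j)
    (y : D.obj j') (h : c.ι.app j x = c.ι.app j' y) :
    ∃ (k : K) (f : j ⟶ k) (g : j' ⟶ k), D.map f x = D.map g y := by
  let e : AsSmall.{u + 1} K ≌ K := AsSmall.equiv.symm
  haveI : IsFiltered (AsSmall.{u + 1} K) := IsFiltered.of_equivalence e.symm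
  let hc' : IsColimit (c.whisker e.functor) := hc.whiskerEquivalence e
  have h' : (c.whisker e.functor).ι.app (AsSmall.up.obj j) x =
      (c.whisker e.functor).ι.app (AsSmall.up.obj j') y := h
  obtain ⟨k, f, g, hfg⟩ := (Concrete.isColimit_rep_eq_iff_exists (e.functor ⋙ D) hc' x y).1 h'
  exact ⟨e.functor.obj k, e.functor.map f, e.functor.map g, hfg⟩

variable {X}

/-- A morphism `g : V → T` of `X_proét`, from any `V` to (the image of) `T ∈ X_ét`, whose image
lies in the open `A ⊆ T`, factors through the open subobject `A`. [folklore] -/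
theorem exists_comp_map_etOfOpensι_eq (T : X.Etale) (A : T.left.Opens) {V : X.ProEt}
    (g : V ⟶ (etaleToProet X).obj T) (h : Set.range g.left ⊆ (A : Set T.left)) :
    ∃ g' : V ⟶ (etaleToProet X).obj (etOfOpens T A),
      g' ≫ (etaleToProet X).map (etOfOpensι T A) = g :=
  ⟨MorphismProperty.Over.homMk
    (IsOpenImmersion.lift A.ι g.left (h.trans (Scheme.Opens.range_ι A).symm.subset) :
      V.left ⟶ (A : Scheme.{u}))
    (((Category.assoc _ _ _).symm.trans (congrArg (· ≫ T.hom)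
      (IsOpenImmersion.lift_fac A.ι g.left
        (h.trans (Scheme.Opens.range_ι A).symm.subset)))).trans
      (Over.w ((Scheme.ProEt.forget X).map g))),
    MorphismProperty.Over.Hom.ext (IsOpenImmersion.lift_fac A.ι g.left _)⟩

end General

/-! ### Gluing compatible sections of an étale sheaf over a finite jointly surjective family -/

section Glue

variable {X : Scheme.{u}}

/-- **Gluing in an étale sheaf**: sections `s'_k ∈ F(T_k)` over a finite jointly surjective
family of étale maps `τ_k : T_k → U`, compatible in the sense that `s'_k|_Z = s'_l|_Z` whenever
`Z → T_k`, `Z → T_l` agree over `U`, glue to a section of `F(U)` (Mathlib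
`Presieve.isSheafFor_arrows_iff`). [folklore] -/
theorem exists_map_eq_of_arrows_compatible (F : Sheaf X.smallEtaleTopology Ab.{u + 1})
    {U : X.Etale} {ι : Type} (T : ι → X.Etale) (τ : ∀ k, T k ⟶ U)
    (hsurj : ∀ x : U.left, ∃ (k : ι) (y : (T k).left), (τ k).left y = x)
    (s' : ∀ k, F.obj.obj (op (T k)))
    (hcompat : ∀ (k l : ι) (Z : X.Etale) (a : Z ⟶ T k) (b : Z ⟶ T l), a ≫ τ k = b ≫ τ l →
      F.obj.map a.op (s' k) = F.obj.map b.op (s' l)) :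
    ∃ s : F.obj.obj (op U), ∀ k, F.obj.map (τ k).op s = s' k := by
  have hsheaf : Presieve.IsSheaf X.smallEtaleTopology (F.obj ⋙ forget Ab.{u + 1}) :=
    (isSheaf_iff_isSheaf_of_type _ _).1 ((sheafCompose _ (forget Ab.{u + 1})).obj F).property
  have hR : Sieve.generate (Presieve.ofArrows T τ) ∈ X.smallEtaleTopology U := by
    refine mem_smallEtaleTopology_of_exists _ fun x => ?_
    obtain ⟨k, y, hy⟩ := hsurj x
    exact ⟨T k, τ k, ⟨T k, 𝟙 _, τ k, Presieve.ofArrows.mk k, Category.id_comp _⟩, y, hy⟩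
  have hfor : Presieve.IsSheafFor (F.obj ⋙ forget Ab.{u + 1}) (Presieve.ofArrows T τ) :=
    (Presieve.isSheafFor_iff_generate _).2 (hsheaf _ hR)
  rw [Presieve.isSheafFor_arrows_iff] at hfor
  obtain ⟨s, hs, -⟩ := hfor s' fun k l Z a b hab => hcompat k l Z a b hab
  exact ⟨s, hs⟩

end Glue

/-! ### Checking a candidate preimage on a finite affine cover -/

section Verify

variable {X : Scheme.{u}} {W : X.ProEt} (𝔭 : ProetAffinePresentation X W)

/-- **The glued section maps to `t`.** Given `t ∈ ν*F(W)` and local data — a finite jointly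
surjective family `v_k : V_k → W` of affine objects of `X_proét`, factorizations
`V_k → T_k → U_i` of `V_k → W → U_i` with `T_k ∈ X_ét`, and sections `s'_k ∈ F(T_k)` whose
images in `(Lan F)(V_k)` lift `t|_{V_k}` — a section `s ∈ F(U_i)` restricting to the `s'_k` has
`[s] ↦ t`: both sides agree on the covering family `{V_k → W}` (an fpqc cover by finitely many
affines) and `ν*F` is separated. [cite: BhattScholze2015, Lemma 5.1.1] -/
theorem ProetAffinePresentation.toSheafify_lanCocone_ι_app_eq
    (F : Sheaf X.smallEtaleTopology Ab.{u + 1})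
    (t : (sheafify (Scheme.ProEt.topology X) ((etaleToProet X).op.lan.obj F.obj)).obj (op W))
    (i : 𝔭.ι) {ι : Type} [Finite ι] (V : ι → X.ProEt) [∀ k, IsAffine (V k).left]
    (v : ∀ k, V k ⟶ W) (hcov : ∀ w : W.left, ∃ (k : ι) (x : (V k).left), (v k).left x = w)
    (T : ι → X.Etale) (τ : ∀ k, T k ⟶ 𝔭.diagram.obj i)
    (g : ∀ k, V k ⟶ (etaleToProet X).obj (T k))
    (hcomm : ∀ k, g k ≫ (etaleToProet X).map (τ k) = v k ≫ 𝔭.π.app i)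
    (s' : ∀ k, F.obj.obj (op (T k)))
    (hlift : ∀ k, (toSheafify (Scheme.ProEt.topology X) ((etaleToProet X).op.lan.obj F.obj)).app
      (op (V k)) (((etaleToProet X).op.lan.obj F.obj).map (g k).op
        (((etaleToProet X).op.lanUnit.app F.obj).app (op (T k)) (s' k))) =
      (sheafify (Scheme.ProEt.topology X) ((etaleToProet X).op.lan.obj F.obj)).map (v k).op t)
    (s : F.obj.obj (op (𝔭.diagram.obj i))) (hs : ∀ k, F.obj.map (τ k).op s = s' k) :
    (toSheafify (Scheme.ProEt.topology X) ((etaleToProet X).op.lan.obj F.obj)).app (op W)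
      ((𝔭.lanCocone F.obj).ι.app (op i) s) = t := by
  -- notation
  let J := Scheme.ProEt.topology X
  let P := (etaleToProet X).op.lan.obj F.obj
  let σ := toSheafify J P
  haveI : IsAffine W.left := isAffine_left_of_presentation 𝔭
  -- both sides agree after restriction to each `V k`
  have hk : ∀ k, (sheafify J P).map (v k).op (σ.app (op W) ((𝔭.lanCocone F.obj).ι.app (op i) s)) =
      (sheafify J P).map (v k).op t := by
    intro k
    have hnatσ := (NatTrans.naturality_apply σ (v k).op ((𝔭.lanCocone F.obj).ι.app (op i) s))
    refine hnatσ.symm.trans ?_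
    refine Eq.trans ?_ (hlift k)
    apply congrArg (σ.app (op (V k)))
    -- `[s]|_{v k} = (η s'_k)|_{g k}` in `P(V k)`
    have h1 : (𝔭.lanCocone F.obj).ι.app (op i) s =
        P.map (𝔭.π.app i).op (((etaleToProet X).op.lanUnit.app F.obj).app
          (op (𝔭.diagram.obj i)) s) := (𝔭.lan_map_π_lanUnit_apply F.obj i s).symm
    have hnatη : ((etaleToProet X).op.lanUnit.app F.obj).app (op (T k)) (F.obj.map (τ k).op s) =
        P.map ((etaleToProet X).map (τ k)).op
          (((etaleToProet X).op.lanUnit.app F.obj).app (op (𝔭.diagram.obj i)) s) :=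
      NatTrans.naturality_apply ((etaleToProet X).op.lanUnit.app F.obj) (τ k).op s
    rw [h1, ← hs k, hnatη]
    refine (ConcreteCategory.congr_hom (P.map_comp (𝔭.π.app i).op (v k).op) _).symm.trans ?_
    refine Eq.trans ?_ (ConcreteCategory.congr_hom (P.map_comp ((etaleToProet X).map (τ k)).op
      (g k).op) _)
    exact congrArg (fun φ => P.map φ.op (((etaleToProet X).op.lanUnit.app F.obj).app
      (op (𝔭.diagram.obj i)) s)) (hcomm k).symm
  -- the `v k` generate a covering sieve, and `P^#` is separated
  have hS : Sieve.ofArrows V v ∈ J W := ofArrows_mem_proEtTopology V v hcov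
  refine (Sheaf.isSeparated ((presheafToSheaf J Ab.{u + 1}).obj P)) W (Sieve.ofArrows V v) hS
    _ _ fun Y f hf => ?_
  obtain ⟨Y', h, f', ⟨k⟩, rfl⟩ := hf
  change (sheafify J P).map (h ≫ v k).op _ = (sheafify J P).map (h ≫ v k).op t
  rw [op_comp, Functor.map_comp, ConcreteCategory.comp_apply, ConcreteCategory.comp_apply, hk k]

end Verify

/-! ### Step 1: local lifts of `t` on a finite affine cover, dominated by `U_i` -/

section LocalLifts

variable {X : Scheme.{u}} {W : X.ProEt} (𝔭 : ProetAffinePresentation X W)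

/-- **Local lifts.** For `t ∈ ν*F(W) = (Lan F)^#(W)` and any index `i`, there are finitely many
affine `V_k ∈ X_proét` with `v_k : V_k → W` jointly surjective, étale `X`-schemes `T_k` with maps
`τ_k : T_k → U_i` and `g_k : V_k → T_k` factorizing `V_k → W → U_i`, and sections `s'_k ∈ F(T_k)`
whose images in `(Lan F)(V_k)` lift `t|_{V_k}`: sheafification is locally surjective, pro-étale
covers of the affine `W` are refined by finitely many affines (fpqc, Def. 4.1.1), elements of
`(Lan F)(V_k)` come from some `F(T)` with `V_k → T`, and `T` may be replaced by `T ×_X U_i`.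
[cite: BhattScholze2015, Lemma 5.1.1 (proof)] -/
theorem ProetAffinePresentation.exists_local_lifts (F : Sheaf X.smallEtaleTopology Ab.{u + 1})
    (t : (sheafify (Scheme.ProEt.topology X) ((etaleToProet X).op.lan.obj F.obj)).obj (op W))
    (i : 𝔭.ι) :
    ∃ (n : ℕ) (V : Fin n → X.ProEt) (v : ∀ k, V k ⟶ W) (T : Fin n → X.Etale)
      (τ : ∀ k, T k ⟶ 𝔭.diagram.obj i) (g : ∀ k, V k ⟶ (etaleToProet X).obj (T k))
      (s' : ∀ k, F.obj.obj (op (T k))),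
      (∀ k, IsAffine (V k).left) ∧
      (∀ w : W.left, ∃ (k : Fin n) (x : (V k).left), (v k).left x = w) ∧
      (∀ k, g k ≫ (etaleToProet X).map (τ k) = v k ≫ 𝔭.π.app i) ∧
      (∀ k, (toSheafify (Scheme.ProEt.topology X) ((etaleToProet X).op.lan.obj F.obj)).app
        (op (V k)) (((etaleToProet X).op.lan.obj F.obj).map (g k).op
          (((etaleToProet X).op.lanUnit.app F.obj).app (op (T k)) (s' k))) =
        (sheafify (Scheme.ProEt.topology X) ((etaleToProet X).op.lan.obj F.obj)).map
          (v k).op t) := by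
  -- notation
  let J := Scheme.ProEt.topology X
  let P := (etaleToProet X).op.lan.obj F.obj
  let σ := toSheafify J P
  let η := fun (U : X.Etale) => ((etaleToProet X).op.lanUnit.app F.obj).app (op U)
  let Uᵢ := 𝔭.diagram.obj i
  haveI : IsAffine W.left := isAffine_left_of_presentation 𝔭
  -- `t` lifts locally, on a finite affine cover
  have hR := Presheaf.imageSieve_mem J σ t
  obtain ⟨n, V, v, hVaff, hRv, hcov⟩ := exists_finite_affine_of_mem_proEtTopology hR
  choose x hx using hRv
  -- represent the lifts
  have hrep : ∀ k, ∃ (T₀ : X.Etale) (φ : V k ⟶ (etaleToProet X).obj T₀) (s₀ : F.obj.obj (op T₀)),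
      x k = P.map φ.op (η T₀ s₀) := fun k => exists_eq_lan_map_lanUnit X F.obj (V k) (x k)
  choose T₀ φ s₀ hxrep using hrep
  -- dominate `U_i`: `T k := T₀ k ×_X U_i`
  haveI hT₀ : ∀ k, Etale (T₀ k).hom := fun k => (T₀ k).prop
  haveI hUᵢ : Etale Uᵢ.hom := Uᵢ.prop
  have e1 : ∀ k, Etale (pullback.fst (T₀ k).hom Uᵢ.hom) := fun k =>
    MorphismProperty.pullback_fst _ _ hUᵢ
  have e2 : ∀ k, Etale (pullback.fst (T₀ k).hom Uᵢ.hom ≫ (T₀ k).hom) := fun k =>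
    @Etale.etale_comp _ _ _ _ _ (e1 k) (hT₀ k)
  let T : Fin n → X.Etale := fun k =>
    MorphismProperty.Over.mk ⊤ (pullback.fst (T₀ k).hom Uᵢ.hom ≫ (T₀ k).hom) (e2 k)
  let τ : ∀ k, T k ⟶ Uᵢ := fun k =>
    MorphismProperty.Over.homMk (pullback.snd (T₀ k).hom Uᵢ.hom) pullback.condition.symm
  let ρ : ∀ k, T k ⟶ T₀ k := fun k =>
    MorphismProperty.Over.homMk (pullback.fst (T₀ k).hom Uᵢ.hom) rfl
  have hφ : ∀ k, (φ k).left ≫ (T₀ k).hom = (V k).hom := fun k =>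
    Over.w ((Scheme.ProEt.forget X).map (φ k))
  have hvπ : ∀ k, (v k ≫ 𝔭.π.app i).left ≫ Uᵢ.hom = (V k).hom := fun k =>
    Over.w ((Scheme.ProEt.forget X).map (v k ≫ 𝔭.π.app i))
  let gl : ∀ k, (V k).left ⟶ (T k).left := fun k =>
    pullback.lift (φ k).left (v k ≫ 𝔭.π.app i).left ((hφ k).trans (hvπ k).symm)
  have hgl : ∀ k, gl k ≫ (T k).hom = (V k).hom := fun k =>
    ((Category.assoc _ _ _).symm.trans (congrArg (· ≫ (T₀ k).hom)
      (pullback.lift_fst _ _ _))).trans (hφ k)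
  let g : ∀ k, V k ⟶ (etaleToProet X).obj (T k) := fun k =>
    MorphismProperty.Over.homMk (gl k) (hgl k)
  have hgρ : ∀ k, g k ≫ (etaleToProet X).map (ρ k) = φ k := fun k =>
    MorphismProperty.Over.Hom.ext (pullback.lift_fst _ _ _)
  refine ⟨n, V, v, T, τ, g, fun k => F.obj.map (ρ k).op (s₀ k), hVaff, hcov,
    fun k => MorphismProperty.Over.Hom.ext (pullback.lift_snd _ _ _), fun k => ?_⟩
  -- the lift property
  have hnatη : η (T k) (F.obj.map (ρ k).op (s₀ k)) =
      P.map ((etaleToProet X).map (ρ k)).op (η (T₀ k) (s₀ k)) :=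
    NatTrans.naturality_apply ((etaleToProet X).op.lanUnit.app F.obj) (ρ k).op (s₀ k)
  refine Eq.trans ?_ (hx k)
  apply congrArg (σ.app (op (V k)))
  change P.map (g k).op (η (T k) (F.obj.map (ρ k).op (s₀ k))) = x k
  rw [hnatη, hxrep k]
  refine (ConcreteCategory.congr_hom (P.map_comp ((etaleToProet X).map (ρ k)).op (g k).op)
    _).symm.trans ?_
  exact congrArg (fun ψ => P.map ψ.op (η (T₀ k) (s₀ k))) (hgρ k)

/-- Transport of points along an equality of indices (for reindexing finite families).
[folklore] -/
theorem exists_apply_eq_of_eq {ι : Type*} (V : ι → X.ProEt) (v : ∀ k, V k ⟶ W) {p p' : ι}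
    (h : p = p') (x : (V p).left) : ∃ x' : (V p').left, (v p').left x' = (v p).left x := by
  subst h
  exact ⟨x, rfl⟩

/-- **Local lifts with affine `T_k`.** As `exists_local_lifts`, with the étale `X`-schemes
`T_k` affine: cover each `T_k` by affine opens, each `V_k` by affine opens mapping into them,
and keep finitely many by quasi-compactness of the affine `V_k`. [cite: BhattScholze2015, Lemma 5.1.1 (proof)] -/
theorem ProetAffinePresentation.exists_local_lifts_affine
    (F : Sheaf X.smallEtaleTopology Ab.{u + 1})
    (t : (sheafify (Scheme.ProEt.topology X) ((etaleToProet X).op.lan.obj F.obj)).obj (op W))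
    (i : 𝔭.ι) :
    ∃ (n : ℕ) (V : Fin n → X.ProEt) (v : ∀ k, V k ⟶ W) (T : Fin n → X.Etale)
      (τ : ∀ k, T k ⟶ 𝔭.diagram.obj i) (g : ∀ k, V k ⟶ (etaleToProet X).obj (T k))
      (s' : ∀ k, F.obj.obj (op (T k))),
      (∀ k, IsAffine (V k).left) ∧ (∀ k, IsAffine (T k).left) ∧
      (∀ w : W.left, ∃ (k : Fin n) (x : (V k).left), (v k).left x = w) ∧
      (∀ k, g k ≫ (etaleToProet X).map (τ k) = v k ≫ 𝔭.π.app i) ∧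
      (∀ k, (toSheafify (Scheme.ProEt.topology X) ((etaleToProet X).op.lan.obj F.obj)).app
        (op (V k)) (((etaleToProet X).op.lan.obj F.obj).map (g k).op
          (((etaleToProet X).op.lanUnit.app F.obj).app (op (T k)) (s' k))) =
        (sheafify (Scheme.ProEt.topology X) ((etaleToProet X).op.lan.obj F.obj)).map
          (v k).op t) := by
  classical
  -- notation
  let J := Scheme.ProEt.topology X
  let P := (etaleToProet X).op.lan.obj F.obj
  let σ := toSheafify J P
  let η := fun (U : X.Etale) => ((etaleToProet X).op.lanUnit.app F.obj).app (op U)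
  obtain ⟨n, V, v, T, τ, g, s', hVaff, hcov, hcomm, hlift⟩ := 𝔭.exists_local_lifts F t i
  -- affine opens `B ∋ x` of `V k` mapping into affine opens `A` of `T k`
  have hAB : ∀ (k : Fin n) (x : (V k).left), ∃ (A : (T k).left.Opens) (B : (V k).left.Opens),
      IsAffineOpen A ∧ IsAffineOpen B ∧ x ∈ B ∧ B ≤ (g k).left ⁻¹ᵁ A := by
    intro k x
    obtain ⟨A, hA, hxA, -⟩ := (TopologicalSpace.Opens.isBasis_iff_nbhd.1
      (T k).left.isBasis_affineOpens) (TopologicalSpace.Opens.mem_top ((g k).left x))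
    obtain ⟨B, hB, hxB, hBA⟩ := (TopologicalSpace.Opens.isBasis_iff_nbhd.1
      (V k).left.isBasis_affineOpens) (show x ∈ (g k).left ⁻¹ᵁ A from hxA)
    exact ⟨A, B, hA, hB, hxB, hBA⟩
  choose A B hA hB hxB hBA using hAB
  have hfin : ∀ k : Fin n, ∃ S : Finset (V k).left, ∀ y : (V k).left, ∃ x ∈ S, y ∈ B k x := by
    intro k
    haveI : IsAffine (V k).left := hVaff k
    obtain ⟨S, hS⟩ := isCompact_univ.elim_finite_subcover (fun x => (B k x : Set (V k).left))
      (fun x => (B k x).isOpen) fun y _ => Set.mem_iUnion.2 ⟨y, hxB k y⟩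
    refine ⟨S, fun y => ?_⟩
    simpa only [Set.mem_iUnion, exists_prop, SetLike.mem_coe] using hS (Set.mem_univ y)
  choose S hS using hfin
  -- the refined family, indexed by `Σ k, S k`, and its lifts into the opens `A`
  let κ := Σ k, ↥(S k)
  let V₁ : κ → X.ProEt := fun p => proetOfOpens (V p.1) (B p.1 p.2)
  let v₁ : ∀ p, V₁ p ⟶ W := fun p => proetOfOpensι (V p.1) (B p.1 p.2) ≫ v p.1
  let T₁ : κ → X.Etale := fun p => etOfOpens (T p.1) (A p.1 p.2)
  let τ₁ : ∀ p, T₁ p ⟶ 𝔭.diagram.obj i := fun p => etOfOpensι (T p.1) (A p.1 p.2) ≫ τ p.1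
  have hg' : ∀ p : κ, ∃ g' : V₁ p ⟶ (etaleToProet X).obj (T₁ p),
      g' ≫ (etaleToProet X).map (etOfOpensι (T p.1) (A p.1 p.2)) =
        proetOfOpensι (V p.1) (B p.1 p.2) ≫ g p.1 := by
    intro p
    refine exists_comp_map_etOfOpensι_eq (T p.1) (A p.1 p.2) _ ?_
    rintro _ ⟨y, rfl⟩
    exact hBA p.1 p.2 y.2
  choose g₁ hg₁ using hg'
  let s₁ : ∀ p, F.obj.obj (op (T₁ p)) := fun p =>
    F.obj.map (etOfOpensι (T p.1) (A p.1 p.2)).op (s' p.1)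
  have hcov₁ : ∀ w : W.left, ∃ (p : κ) (x : (V₁ p).left), (v₁ p).left x = w := by
    intro w
    obtain ⟨k, y, rfl⟩ := hcov w
    obtain ⟨x, hxS, hyx⟩ := hS k y
    exact ⟨⟨k, x, hxS⟩, ⟨y, hyx⟩, rfl⟩
  have hcomm₁ : ∀ p, g₁ p ≫ (etaleToProet X).map (τ₁ p) = v₁ p ≫ 𝔭.π.app i := fun p =>
    (congrArg (g₁ p ≫ ·) ((etaleToProet X).map_comp _ _)).trans
      ((Category.assoc _ _ _).symm.trans ((congrArg (· ≫ (etaleToProet X).map (τ p.1))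
        (hg₁ p)).trans ((Category.assoc _ _ _).trans
          ((congrArg (proetOfOpensι (V p.1) (B p.1 p.2) ≫ ·) (hcomm p.1)).trans
            (Category.assoc _ _ _).symm))))
  have hlift₁ : ∀ p, σ.app (op (V₁ p)) (P.map (g₁ p).op (η (T₁ p) (s₁ p))) =
      (sheafify J P).map (v₁ p).op t := by
    intro p
    have hnatη : η (T₁ p) (s₁ p) =
        P.map ((etaleToProet X).map (etOfOpensι (T p.1) (A p.1 p.2))).op (η (T p.1) (s' p.1)) :=
      NatTrans.naturality_apply ((etaleToProet X).op.lanUnit.app F.obj)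
        (etOfOpensι (T p.1) (A p.1 p.2)).op (s' p.1)
    have hnatσ := NatTrans.naturality_apply σ (proetOfOpensι (V p.1) (B p.1 p.2)).op
      (P.map (g p.1).op (η (T p.1) (s' p.1)))
    have h1 : P.map (g₁ p).op (η (T₁ p) (s₁ p)) =
        P.map (proetOfOpensι (V p.1) (B p.1 p.2)).op (P.map (g p.1).op (η (T p.1) (s' p.1))) := by
      rw [hnatη]
      refine (ConcreteCategory.congr_hom (P.map_comp
        ((etaleToProet X).map (etOfOpensι (T p.1) (A p.1 p.2))).op (g₁ p).op) _).symm.trans ?_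
      refine Eq.trans ?_ (ConcreteCategory.congr_hom (P.map_comp (g p.1).op
        (proetOfOpensι (V p.1) (B p.1 p.2)).op) _)
      exact congrArg (fun ψ => P.map ψ.op (η (T p.1) (s' p.1))) (hg₁ p)
    rw [h1]
    refine hnatσ.trans ?_
    refine (congrArg ((sheafify J P).map (proetOfOpensι (V p.1) (B p.1 p.2)).op)
      (hlift p.1)).trans ?_
    exact (ConcreteCategory.congr_hom ((sheafify J P).map_comp (v p.1).op
      (proetOfOpensι (V p.1) (B p.1 p.2)).op) t).symm
  -- reindex by `Fin m`
  obtain ⟨m, ⟨e⟩⟩ := Finite.exists_equiv_fin κ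
  refine ⟨m, fun q => V₁ (e.symm q), fun q => v₁ (e.symm q), fun q => T₁ (e.symm q),
    fun q => τ₁ (e.symm q), fun q => g₁ (e.symm q), fun q => s₁ (e.symm q),
    fun q => hB _ _, fun q => hA _ _, fun w => ?_, fun q => hcomm₁ _, fun q => hlift₁ _⟩
  obtain ⟨p, x, rfl⟩ := hcov₁ w
  obtain ⟨x', hx'⟩ := exists_apply_eq_of_eq V₁ v₁ (e.symm_apply_apply p).symm x
  exact ⟨e p, x', hx'⟩

end LocalLifts

/-! ### Step 2: on overlaps the local lifts agree on an open neighbourhood of the image -/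

section Overlaps

variable {X : Scheme.{u}} {W : X.ProEt} (𝔭 : ProetAffinePresentation X W)

/-- **Agreement on overlaps, near the image.** In the situation of `exists_local_lifts`, for each
pair `k, l` there is an open `O ⊆ T_k ×_{U_i} T_l` such that (a) `s'_k` and `s'_l` agree on every
étale `Z → T_k ×_{U_i} T_l` landing in `O`, and (b) `O` contains the image of every
`Z → T_k ×_{U_i} T_l` induced by a pair `Z → V_k`, `Z → V_l` over `W` (`Z ∈ X_proét`). Proof: `O`
is the union of the (open) images of all étale `T' → T_k ×_{U_i} T_l` on which `s'_k`, `s'_l`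
agree; (a) is the separatedness of `F` (such `Z` is covered by the `Z ×_{T_k × T_l} T'`); for
(b), the two lifts of `t` agree in `ν*F` on `Z`, hence (local injectivity) in `Lan F` on a
pro-étale covering sieve of `Z`, i.e. (filtered colimit) in `F` on étale patches `T'` through
which the members of the sieve factor — after equalizing the two maps `T' ⇉ U_i` (filteredness).
[cite: BhattScholze2015, Lemma 5.1.1 (proof)] -/
theorem ProetAffinePresentation.exists_opens_forall_map_eq
    (F : Sheaf X.smallEtaleTopology Ab.{u + 1})
    (t : (sheafify (Scheme.ProEt.topology X) ((etaleToProet X).op.lan.obj F.obj)).obj (op W))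
    (i : 𝔭.ι) {ι : Type} (V : ι → X.ProEt) (v : ∀ k, V k ⟶ W) (T : ι → X.Etale)
    (τ : ∀ k, T k ⟶ 𝔭.diagram.obj i) (g : ∀ k, V k ⟶ (etaleToProet X).obj (T k))
    (hcomm : ∀ k, g k ≫ (etaleToProet X).map (τ k) = v k ≫ 𝔭.π.app i)
    (s' : ∀ k, F.obj.obj (op (T k)))
    (hlift : ∀ k, (toSheafify (Scheme.ProEt.topology X) ((etaleToProet X).op.lan.obj F.obj)).app
      (op (V k)) (((etaleToProet X).op.lan.obj F.obj).map (g k).op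
        (((etaleToProet X).op.lanUnit.app F.obj).app (op (T k)) (s' k))) =
      (sheafify (Scheme.ProEt.topology X) ((etaleToProet X).op.lan.obj F.obj)).map (v k).op t)
    (k l : ι) :
    ∃ O : (pullback (τ k).left (τ l).left).Opens,
      (∀ (Z : X.Etale) (a : Z ⟶ T k) (b : Z ⟶ T l)
          (m : Z.left ⟶ pullback (τ k).left (τ l).left),
          m ≫ pullback.fst _ _ = a.left → m ≫ pullback.snd _ _ = b.left →
          Set.range m ⊆ (O : Set ↥(pullback (τ k).left (τ l).left)) →
          F.obj.map a.op (s' k) = F.obj.map b.op (s' l)) ∧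
      (∀ (Z : X.ProEt) (a : Z ⟶ V k) (b : Z ⟶ V l)
          (m : Z.left ⟶ pullback (τ k).left (τ l).left),
          a ≫ v k = b ≫ v l → m ≫ pullback.fst _ _ = (a ≫ g k).left →
          m ≫ pullback.snd _ _ = (b ≫ g l).left →
          Set.range m ⊆ (O : Set ↥(pullback (τ k).left (τ l).left))) := by
  -- notation
  let J := Scheme.ProEt.topology X
  let E := etaleToProet X
  let P := E.op.lan.obj F.obj
  let σ := toSheafify J P
  let η := fun (U : X.Etale) => (E.op.lanUnit.app F.obj).app (op U)
  let Uᵢ := 𝔭.diagram.obj i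
  let Qs := pullback (τ k).left (τ l).left
  -- the agreement patches and their images
  let AG := Σ T' : X.Etale, {ab : (T' ⟶ T k) × (T' ⟶ T l) //
    ab.1 ≫ τ k = ab.2 ≫ τ l ∧ F.obj.map ab.1.op (s' k) = F.obj.map ab.2.op (s' l)}
  let c : ∀ q : AG, q.1.left ⟶ Qs := fun q =>
    pullback.lift q.2.1.1.left q.2.1.2.left
      (congrArg (fun f : q.1 ⟶ Uᵢ => f.left) q.2.2.1 :)
  have hc_fst : ∀ q : AG, c q ≫ pullback.fst _ _ = q.2.1.1.left := fun q => pullback.lift_fst _ _ _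
  have hc_snd : ∀ q : AG, c q ≫ pullback.snd _ _ = q.2.1.2.left := fun q => pullback.lift_snd _ _ _
  have hcet : ∀ q : AG, Etale (c q) := by
    intro q
    haveI : Etale (pullback.fst (τ k).left (τ l).left) :=
      MorphismProperty.pullback_fst _ _ (inferInstance : Etale (τ l).left)
    have : Etale (c q ≫ pullback.fst (τ k).left (τ l).left) :=
      (hc_fst q).symm ▸ (inferInstance : Etale q.2.1.1.left)
    exact Etale.of_comp (c q) (pullback.fst (τ k).left (τ l).left)
  have hopen : ∀ q : AG, IsOpen (Set.range (c q)) := fun q => by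
    haveI := hcet q
    exact (c q).isOpenMap.isOpen_range
  let O : Qs.Opens := ⨆ q : AG, ⟨Set.range (c q), hopen q⟩
  have hO : ∀ q : AG, Set.range (c q) ⊆ (O : Set Qs) := fun q y hy =>
    TopologicalSpace.Opens.mem_iSup.2 ⟨q, hy⟩
  refine ⟨O, fun Z a b m hma hmb hrange => ?_, fun Z a b m hab hma hmb => ?_⟩
  · /- (a) agreement on `Z` landing in `O`: the agreement sieve of `Z` is covering -/
    let R : Sieve Z :=
      { arrows := fun Y r => F.obj.map (r ≫ a).op (s' k) = F.obj.map (r ≫ b).op (s' l)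
        downward_closed := by
          intro Y Y' r hr r'
          calc F.obj.map ((r' ≫ r) ≫ a).op (s' k)
              = F.obj.map (r' ≫ r ≫ a).op (s' k) := by simp only [Category.assoc]
            _ = F.obj.map r'.op (F.obj.map (r ≫ a).op (s' k)) :=
                ConcreteCategory.congr_hom (F.obj.map_comp _ _) _
            _ = F.obj.map r'.op (F.obj.map (r ≫ b).op (s' l)) := by rw [hr]
            _ = F.obj.map (r' ≫ r ≫ b).op (s' l) :=
                (ConcreteCategory.congr_hom (F.obj.map_comp _ _) _).symm
            _ = F.obj.map ((r' ≫ r) ≫ b).op (s' l) := by simp only [Category.assoc] }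
    have hR : R ∈ X.smallEtaleTopology Z := by
      refine mem_smallEtaleTopology_of_exists R fun z => ?_
      obtain ⟨q, hq⟩ := TopologicalSpace.Opens.mem_iSup.1 (hrange ⟨z, rfl⟩)
      obtain ⟨y, hy⟩ := hq
      -- the patch `Z ×_{Qs} T'`
      haveI := hcet q
      have e1 : Etale (pullback.fst m (c q)) := MorphismProperty.pullback_fst _ _ (hcet q)
      have e2 : Etale (pullback.fst m (c q) ≫ Z.hom) :=
        @Etale.etale_comp _ _ _ _ _ e1 Z.prop
      let Zc : X.Etale := MorphismProperty.Over.mk ⊤ (pullback.fst m (c q) ≫ Z.hom) e2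
      let r : Zc ⟶ Z := MorphismProperty.Over.homMk (pullback.fst m (c q)) rfl
      have hZ : a.left ≫ (T k).hom = Z.hom := Over.w ((Scheme.Etale.forget X).map a)
      have hT' : q.2.1.1.left ≫ (T k).hom = q.1.hom := Over.w ((Scheme.Etale.forget X).map q.2.1.1)
      have he : pullback.snd m (c q) ≫ q.1.hom = pullback.fst m (c q) ≫ Z.hom :=
        (congrArg (pullback.snd m (c q) ≫ ·) hT'.symm).trans
          ((congrArg (fun x => pullback.snd m (c q) ≫ (x ≫ (T k).hom)) (hc_fst q).symm).trans
          ((Category.assoc _ _ _).trans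
          ((Category.assoc _ _ _).symm.trans
          ((congrArg (· ≫ (pullback.fst (τ k).left (τ l).left ≫ (T k).hom))
            pullback.condition.symm).trans
          ((Category.assoc _ _ _).trans
          ((congrArg (pullback.fst m (c q) ≫ ·) (Category.assoc _ _ _).symm).trans
          ((congrArg (fun x => pullback.fst m (c q) ≫ (x ≫ (T k).hom)) hma).trans
          (congrArg (pullback.fst m (c q) ≫ ·) hZ))))))))
      let e : Zc ⟶ q.1 := MorphismProperty.Over.homMk (pullback.snd m (c q)) he
      have hra : r ≫ a = e ≫ q.2.1.1 := MorphismProperty.Over.Hom.ext (by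
        change pullback.fst m (c q) ≫ a.left = pullback.snd m (c q) ≫ q.2.1.1.left
        rw [← hma, ← hc_fst q, ← Category.assoc, pullback.condition, Category.assoc])
      have hrb : r ≫ b = e ≫ q.2.1.2 := MorphismProperty.Over.Hom.ext (by
        change pullback.fst m (c q) ≫ b.left = pullback.snd m (c q) ≫ q.2.1.2.left
        rw [← hmb, ← hc_snd q, ← Category.assoc, pullback.condition, Category.assoc])
      obtain ⟨p, hp, -⟩ := Scheme.Pullback.exists_preimage_pullback (f := m) (g := c q) z y
        hy.symm
      refine ⟨Zc, r, ?_, p, hp⟩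
      change F.obj.map (r ≫ a).op (s' k) = F.obj.map (r ≫ b).op (s' l)
      rw [hra, hrb, op_comp, F.obj.map_comp, op_comp, F.obj.map_comp,
        ConcreteCategory.comp_apply, ConcreteCategory.comp_apply, q.2.2.2]
    refine (Sheaf.isSeparated F) Z R hR _ _ fun Y r hr => ?_
    rw [← ConcreteCategory.comp_apply, ← ConcreteCategory.comp_apply, ← F.obj.map_comp,
      ← F.obj.map_comp, ← op_comp, ← op_comp]
    exact hr
  · /- (b) the image of `Z → Qs` for `Z` over `V k ×_W V l` lies in `O` -/
    rintro _ ⟨z, rfl⟩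
    -- the two lifts agree in `P^#(Z)`, hence in `P` on a covering sieve of `Z`
    let α := P.map (a ≫ g k).op (η (T k) (s' k))
    let β := P.map (b ≫ g l).op (η (T l) (s' l))
    have hσ : ∀ (k' : ι) (a' : Z ⟶ V k'), σ.app (op Z) (P.map (a' ≫ g k').op (η (T k') (s' k'))) =
        (sheafify J P).map (a' ≫ v k').op t := by
      intro k' a'
      have hnat := NatTrans.naturality_apply σ a'.op (P.map (g k').op (η (T k') (s' k')))
      rw [op_comp, P.map_comp, ConcreteCategory.comp_apply]
      refine hnat.trans ?_
      refine (congrArg ((sheafify J P).map a'.op) (hlift k')).trans ?_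
      exact (ConcreteCategory.congr_hom ((sheafify J P).map_comp (v k').op a'.op) t).symm
    have hαβ : σ.app (op Z) α = σ.app (op Z) β := by
      refine (hσ k a).trans (Eq.trans ?_ (hσ l b).symm)
      rw [hab]
    have hS := Presheaf.equalizerSieve_mem J σ α β hαβ
    obtain ⟨Z', h, hh, z', rfl⟩ := exists_mem_of_mem_proEtTopology hS z
    -- in the filtered colimit `P(Z') = colim_{Z' → T'} F(T')`
    have h₁ : P.map h.op α = ((Functor.LeftExtension.mk _ (E.op.leftKanExtensionUnit F.obj)).coconeAt
        (op Z')).ι.app (CostructuredArrow.mk (h ≫ a ≫ g k).op) (s' k) :=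
      (ConcreteCategory.congr_hom (P.map_comp (a ≫ g k).op h.op) _).symm.trans
        (lan_map_lanUnit_app_apply X F.obj (h ≫ a ≫ g k) (s' k))
    have h₂ : P.map h.op β = ((Functor.LeftExtension.mk _ (E.op.leftKanExtensionUnit F.obj)).coconeAt
        (op Z')).ι.app (CostructuredArrow.mk (h ≫ b ≫ g l).op) (s' l) :=
      (ConcreteCategory.congr_hom (P.map_comp (b ≫ g l).op h.op) _).symm.trans
        (lan_map_lanUnit_app_apply X F.obj (h ≫ b ≫ g l) (s' l))
    obtain ⟨K, f₁, f₂, hf⟩ := exists_map_eq_map_of_isColimit_asSmall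
      (Functor.isPointwiseLeftKanExtensionLeftKanExtensionUnit E.op F.obj (op Z'))
      (j := CostructuredArrow.mk (h ≫ a ≫ g k).op) (j' := CostructuredArrow.mk (h ≫ b ≫ g l).op)
      (s' k) (s' l) (h₁.symm.trans (hh.trans h₂))
    -- `K = (T', zK : Z' → T')`, `a₀ : T' → T k`, `b₀ : T' → T l`
    have w₁ : K.hom.unop ≫ E.map f₁.left.unop = h ≫ a ≫ g k :=
      congrArg Quiver.Hom.unop (CostructuredArrow.w f₁)
    have w₂ : K.hom.unop ≫ E.map f₂.left.unop = h ≫ b ≫ g l :=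
      congrArg Quiver.Hom.unop (CostructuredArrow.w f₂)
    -- equalize the two maps `T' ⇉ U_i`
    have hz₁ : ∀ (k' : ι) (a' : Z ⟶ V k') (T' : X.Etale) (zK : Z' ⟶ E.obj T') (f' : T' ⟶ T k'),
        zK ≫ E.map f' = h ≫ a' ≫ g k' →
        zK ≫ E.map (f' ≫ τ k') = h ≫ ((a' ≫ v k') ≫ 𝔭.π.app i) := by
      intro k' a' T' zK f' w
      exact (congrArg (zK ≫ ·) (E.map_comp _ _)).trans
        ((Category.assoc _ _ _).symm.trans
        ((congrArg (· ≫ E.map (τ k')) w).trans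
        ((Category.assoc _ _ _).trans
        ((congrArg (h ≫ ·) (Category.assoc _ _ _)).trans
        ((congrArg (fun x => h ≫ (a' ≫ x)) (hcomm k')).trans
        (congrArg (h ≫ ·) (Category.assoc _ _ _).symm))))))
    have hz : K.hom.unop ≫ E.map (f₁.left.unop ≫ τ k) =
        K.hom.unop ≫ E.map (f₂.left.unop ≫ τ l) :=
      (hz₁ k a _ _ _ w₁).trans ((congrArg (fun x => h ≫ (x ≫ 𝔭.π.app i)) hab).trans
        (hz₁ l b _ _ _ w₂).symm)
    let KU : CostructuredArrow E.op (op Z') :=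
      CostructuredArrow.mk (K.hom.unop ≫ E.map (f₁.left.unop ≫ τ k)).op
    let φ₁ : KU ⟶ K := CostructuredArrow.homMk (f₁.left.unop ≫ τ k).op rfl
    let φ₂ : KU ⟶ K := CostructuredArrow.homMk (f₂.left.unop ≫ τ l).op
      (congrArg Quiver.Hom.op hz).symm
    let n := IsFiltered.coeqHom φ₁ φ₂
    have hn : φ₁ ≫ n = φ₂ ≫ n := IsFiltered.coeq_condition φ₁ φ₂
    have hn' : n.left.unop ≫ (f₁.left.unop ≫ τ k) = n.left.unop ≫ (f₂.left.unop ≫ τ l) :=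
      congrArg (fun ψ : KU ⟶ IsFiltered.coeq φ₁ φ₂ => ψ.left.unop) hn
    have wn : (IsFiltered.coeq φ₁ φ₂).hom.unop ≫ E.map n.left.unop = K.hom.unop :=
      congrArg Quiver.Hom.unop (CostructuredArrow.w n)
    -- the agreement patch `T'' := (coeq φ₁ φ₂).left.unop`
    let a₁ : (IsFiltered.coeq φ₁ φ₂).left.unop ⟶ T k := n.left.unop ≫ f₁.left.unop
    let b₁ : (IsFiltered.coeq φ₁ φ₂).left.unop ⟶ T l := n.left.unop ≫ f₂.left.unop
    have hab₁ : a₁ ≫ τ k = b₁ ≫ τ l :=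
      ((Category.assoc _ _ _).trans hn').trans (Category.assoc _ _ _).symm
    have hF₁ : F.obj.map a₁.op (s' k) = F.obj.map b₁.op (s' l) :=
      (ConcreteCategory.congr_hom (F.obj.map_comp f₁.left n.left) (s' k)).trans
        ((congrArg (F.obj.map n.left) hf).trans
          (ConcreteCategory.congr_hom (F.obj.map_comp f₂.left n.left) (s' l)).symm)
    let q : AG := ⟨(IsFiltered.coeq φ₁ φ₂).left.unop, ⟨(a₁, b₁), hab₁, hF₁⟩⟩
    -- `h ≫ m` factors through `c q`
    have Y₁ : h ≫ a ≫ g k = (IsFiltered.coeq φ₁ φ₂).hom.unop ≫ E.map a₁ :=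
      w₁.symm.trans ((congrArg (· ≫ E.map f₁.left.unop) wn.symm).trans
        ((Category.assoc _ _ _).trans (congrArg ((IsFiltered.coeq φ₁ φ₂).hom.unop ≫ ·)
          (E.map_comp _ _).symm)))
    have Y₂ : h ≫ b ≫ g l = (IsFiltered.coeq φ₁ φ₂).hom.unop ≫ E.map b₁ :=
      w₂.symm.trans ((congrArg (· ≫ E.map f₂.left.unop) wn.symm).trans
        ((Category.assoc _ _ _).trans (congrArg ((IsFiltered.coeq φ₁ φ₂).hom.unop ≫ ·)
          (E.map_comp _ _).symm)))
    have hfac : h.left ≫ m = (IsFiltered.coeq φ₁ φ₂).hom.unop.left ≫ c q :=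
      pullback.hom_ext
        ((Category.assoc _ _ _).trans ((congrArg (h.left ≫ ·) hma).trans
          ((congrArg (fun ψ : Z' ⟶ E.obj (T k) => ψ.left) Y₁).trans
          ((congrArg ((IsFiltered.coeq φ₁ φ₂).hom.unop.left ≫ ·) (hc_fst q)).trans
            (Category.assoc _ _ _).symm).symm)))
        ((Category.assoc _ _ _).trans ((congrArg (h.left ≫ ·) hmb).trans
          ((congrArg (fun ψ : Z' ⟶ E.obj (T l) => ψ.left) Y₂).trans
          ((congrArg ((IsFiltered.coeq φ₁ φ₂).hom.unop.left ≫ ·) (hc_snd q)).trans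
            (Category.assoc _ _ _).symm).symm)))
    refine hO q ⟨(IsFiltered.coeq φ₁ φ₂).hom.unop.left z', ?_⟩
    exact (congrArg (fun ψ => ψ z') hfac).symm

end Overlaps

/-! ### Step 3: the tube lemma over `W` and descent to some `U_j` -/

section Descent

variable {X : Scheme.{u}} {W : X.ProEt} (𝔭 : ProetAffinePresentation X W)

/-- **Descent of the local data to some `U_j`.** Given affine local data over `U_i` (finite affine
`V_k → W`, affine `T_k ∈ X_ét` with `τ_k : T_k → U_i`, `g_k : V_k → T_k` over `W → U_i`, sections
`s'_k`) such that on each `T_k ×_{U_i} T_l` the sections agree on an open `O_kl` containing the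
image of every `Z → T_k ×_{U_i} T_l` coming from `Z → V_k ×_W V_l`, there are `j`, étale
`T'_k → U_j` through which the `V_k` still factor, maps `ρ_k : T'_k → T_k` under which the `s'_k`
become compatible, and the `T'_k → U_j` are jointly surjective. Proof: over `W`, the tube lemma
(`exists_isOpen_isCompact_preimage_inter_preimage_subset`, for the images of the flat maps
`V_k → W ×_{U_i} T_k`) gives compact opens `C_k ⊆ W ×_{U_i} T_k` through which the `V_k` factor and
with `C_k ×_W C_l` mapping into `O_kl`; as `W ×_{U_i} T_k = lim_j U_j ×_{U_i} T_k`
(`nonempty_isLimit_mapCone_conePost`), the `C_k` descend to compact opens of some `U_j ×_{U_i} T_k`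
(Mathlib `exists_preimage_eq`), the containments descend (`exists_map_preimage_le_map_preimage`)
and so does the joint surjectivity (`exists_map_eq_top`). [cite: BhattScholze2015, Lemma 5.1.1 (proof)]
[cite: StacksProject, Tag 01Z4] -/
theorem ProetAffinePresentation.exists_descended_data
    (F : Sheaf X.smallEtaleTopology Ab.{u + 1}) (i : 𝔭.ι) {n : ℕ} (V : Fin n → X.ProEt)
    (v : ∀ k, V k ⟶ W) (T : Fin n → X.Etale) (τ : ∀ k, T k ⟶ 𝔭.diagram.obj i)
    (g : ∀ k, V k ⟶ (etaleToProet X).obj (T k)) (s' : ∀ k, F.obj.obj (op (T k)))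
    (hVaff : ∀ k, IsAffine (V k).left) (hTaff : ∀ k, IsAffine (T k).left)
    (hcov : ∀ w : W.left, ∃ (k : Fin n) (x : (V k).left), (v k).left x = w)
    (hcomm : ∀ k, g k ≫ (etaleToProet X).map (τ k) = v k ≫ 𝔭.π.app i)
    (hO : ∀ k l, ∃ O : (pullback (τ k).left (τ l).left).Opens,
      (∀ (Z : X.Etale) (a : Z ⟶ T k) (b : Z ⟶ T l)
          (m : Z.left ⟶ pullback (τ k).left (τ l).left),
          m ≫ pullback.fst _ _ = a.left → m ≫ pullback.snd _ _ = b.left →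
          Set.range m ⊆ (O : Set ↥(pullback (τ k).left (τ l).left)) →
          F.obj.map a.op (s' k) = F.obj.map b.op (s' l)) ∧
      (∀ (Z : X.ProEt) (a : Z ⟶ V k) (b : Z ⟶ V l)
          (m : Z.left ⟶ pullback (τ k).left (τ l).left),
          a ≫ v k = b ≫ v l → m ≫ pullback.fst _ _ = (a ≫ g k).left →
          m ≫ pullback.snd _ _ = (b ≫ g l).left →
          Set.range m ⊆ (O : Set ↥(pullback (τ k).left (τ l).left)))) :
    ∃ (j : 𝔭.ι) (T' : Fin n → X.Etale) (τ' : ∀ k, T' k ⟶ 𝔭.diagram.obj j)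
      (ρ : ∀ k, T' k ⟶ T k) (g' : ∀ k, V k ⟶ (etaleToProet X).obj (T' k)),
      (∀ k, g' k ≫ (etaleToProet X).map (ρ k) = g k) ∧
      (∀ k, g' k ≫ (etaleToProet X).map (τ' k) = v k ≫ 𝔭.π.app j) ∧
      (∀ x : (𝔭.diagram.obj j).left, ∃ (k : Fin n) (y : (T' k).left), (τ' k).left y = x) ∧
      (∀ (k l : Fin n) (Z : X.Etale) (a : Z ⟶ T' k) (b : Z ⟶ T' l), a ≫ τ' k = b ≫ τ' l →
        F.obj.map (a ≫ ρ k).op (s' k) = F.obj.map (b ≫ ρ l).op (s' l)) := by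
  classical
  /- ## notation -/
  let E := etaleToProet X
  let U : X.Etale := 𝔭.diagram.obj i
  let πᵢ : W.left ⟶ U.left := (𝔭.π.app i).left
  let tk : ∀ k, (T k).left ⟶ U.left := fun k => (τ k).left
  haveI : IsAffine W.left := isAffine_left_of_presentation 𝔭
  haveI : IsAffine U.left := 𝔭.isAffine i
  haveI : ∀ k, IsAffine (T k).left := hTaff
  haveI : ∀ k, IsAffine (V k).left := hVaff
  haveI hUet : Etale U.hom := U.prop
  haveI htk : ∀ k, Etale (tk k) := fun k => inferInstance
  choose O hOagree hOcont using hO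
  /- ## the objects over `W`: `P k := W ×_{U_i} T_k`, `Q k l := T_k ×_{U_i} T_l`,
    `PQ k l := W ×_{U_i} Q k l` -/
  let gl : ∀ k, (V k).left ⟶ (T k).left := fun k => (g k).left
  let vl : ∀ k, (V k).left ⟶ W.left := fun k => (v k).left
  let P : ∀ k, Scheme.{u} := fun k => pullback πᵢ (tk k)
  have hmP : ∀ k, vl k ≫ πᵢ = gl k ≫ tk k := fun k =>
    (congrArg (fun φ : V k ⟶ E.obj U => φ.left) (hcomm k)).symm
  let mP : ∀ k, (V k).left ⟶ P k := fun k => pullback.lift (vl k) (gl k) (hmP k)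
  let Q : ∀ k l, Scheme.{u} := fun k l => pullback (tk k) (tk l)
  let q : ∀ k l, Q k l ⟶ U.left := fun k l => pullback.fst (tk k) (tk l) ≫ tk k
  let PQ : ∀ k l, Scheme.{u} := fun k l => pullback πᵢ (q k l)
  have e₀ : πᵢ ≫ 𝟙 U.left = 𝟙 W.left ≫ πᵢ := by simp
  have e₁ : ∀ k l, q k l ≫ 𝟙 U.left = pullback.fst (tk k) (tk l) ≫ tk k := fun k l => by simp [q]
  have e₂ : ∀ k l, q k l ≫ 𝟙 U.left = pullback.snd (tk k) (tk l) ≫ tk l := fun k l => by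
    simp [q, pullback.condition]
  let p₁ : ∀ k l, PQ k l ⟶ P k := fun k l =>
    pullback.map πᵢ (q k l) πᵢ (tk k) (𝟙 _) (pullback.fst _ _) (𝟙 _) e₀ (e₁ k l)
  let p₂ : ∀ k l, PQ k l ⟶ P l := fun k l =>
    pullback.map πᵢ (q k l) πᵢ (tk l) (𝟙 _) (pullback.snd _ _) (𝟙 _) e₀ (e₂ k l)
  /- ## Step 1: the tube lemma over `W` -/
  -- the images `I k` of the flat maps `mP k` are saturated
  have hflat : ∀ k, Flat (mP k) := by
    intro k
    haveI : Etale (pullback.fst πᵢ (tk k)) := MorphismProperty.pullback_fst _ _ (htk k)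
    have h1 : WeaklyEtale (mP k ≫ pullback.fst πᵢ (tk k)) :=
      (pullback.lift_fst _ _ (hmP k)).symm ▸ weaklyEtale_left (v k)
    haveI := h1
    exact (WeaklyEtale.of_comp (mP k) (pullback.fst πᵢ (tk k))).flat
  have hsat : ∀ k (x : P k), x ∉ Set.range (mP k) →
      ∃ C : Set (P k), IsOpen C ∧ IsCompact C ∧ Set.range (mP k) ⊆ C ∧ x ∉ C := fun k x hx => by
    haveI := hflat k
    exact exists_isOpen_isCompact_range_subset_notMem (mP k) x hx
  -- the hypothesis of the tube lemma: `p₁⁻¹(I k) ∩ p₂⁻¹(I l) ⊆ snd⁻¹(O k l)`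
  have hH : ∀ k l, p₁ k l ⁻¹' Set.range (mP k) ∩ p₂ k l ⁻¹' Set.range (mP l) ⊆
      pullback.snd πᵢ (q k l) ⁻¹' (O k l : Set (Q k l)) := by
    intro k l x hx
    obtain ⟨⟨a, ha⟩, ⟨b, hb⟩⟩ := hx
    -- `ψ : PQ → P k ×_W P l`, `M : V k ×_W V l → P k ×_W P l`, `θ : P k ×_W P l → Q`
    let fk := pullback.fst πᵢ (tk k)
    let fl := pullback.fst πᵢ (tk l)
    have hψ : p₁ k l ≫ fk = p₂ k l ≫ fl := by
      simp only [p₁, p₂, fk, fl, pullback.lift_fst, Category.comp_id]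
    let ψ : PQ k l ⟶ pullback fk fl := pullback.lift (p₁ k l) (p₂ k l) hψ
    have eM₁ : vl k ≫ 𝟙 W.left = mP k ≫ fk := by
      simp only [mP, fk, pullback.lift_fst, Category.comp_id]
    have eM₂ : vl l ≫ 𝟙 W.left = mP l ≫ fl := by
      simp only [mP, fl, pullback.lift_fst, Category.comp_id]
    let M : pullback (vl k) (vl l) ⟶ pullback fk fl :=
      pullback.map _ _ _ _ (mP k) (mP l) (𝟙 _) eM₁ eM₂
    have hθ : (pullback.fst fk fl ≫ pullback.snd πᵢ (tk k)) ≫ tk k =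
        (pullback.snd fk fl ≫ pullback.snd πᵢ (tk l)) ≫ tk l := by
      have ck : pullback.snd πᵢ (tk k) ≫ tk k = fk ≫ πᵢ := pullback.condition.symm
      have cl : pullback.snd πᵢ (tk l) ≫ tk l = fl ≫ πᵢ := pullback.condition.symm
      simp only [Category.assoc, ck, cl]
      simp only [← Category.assoc, pullback.condition]
    let θ : pullback fk fl ⟶ Q k l := pullback.lift _ _ hθ
    have hψθ : ψ ≫ θ = pullback.snd πᵢ (q k l) := by
      apply pullback.hom_ext <;>
        simp only [ψ, θ, p₁, p₂, fk, fl, pullback.lift_fst, pullback.lift_snd,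
          pullback.lift_fst_assoc, pullback.lift_snd_assoc, Category.assoc]
    have hMθ₁ : (M ≫ θ) ≫ pullback.fst _ _ = pullback.fst _ _ ≫ gl k := by
      simp only [M, θ, mP, fk, fl, pullback.lift_fst, pullback.lift_snd, pullback.lift_fst_assoc,
        Category.assoc]
    have hMθ₂ : (M ≫ θ) ≫ pullback.snd _ _ = pullback.snd _ _ ≫ gl l := by
      simp only [M, θ, mP, fk, fl, pullback.lift_snd, pullback.lift_snd_assoc, Category.assoc]
    -- `ψ x` lies in the image of `M`
    have hrange : ψ x ∈ Set.range M := by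
      rw [Scheme.Pullback.range_map]
      exact ⟨⟨a, ha.trans (congrArg (fun φ => φ x) (pullback.lift_fst _ _ hψ)).symm⟩,
        ⟨b, hb.trans (congrArg (fun φ => φ x) (pullback.lift_snd _ _ hψ)).symm⟩⟩
    obtain ⟨c, hc⟩ := hrange
    -- `V k ×_W V l` as an object of `X_proét` over `V k` and `V l`
    have w₁ : WeaklyEtale (pullback.fst (vl k) (vl l)) :=
      MorphismProperty.pullback_fst _ _ (weaklyEtale_left (v l))
    let Zs : X.ProEt := MorphismProperty.Over.mk ⊤ (pullback.fst (vl k) (vl l) ≫ (V k).hom)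
      (MorphismProperty.comp_mem _ _ _ w₁ (V k).prop)
    let za : Zs ⟶ V k := MorphismProperty.Over.homMk (pullback.fst (vl k) (vl l)) rfl
    have hk : vl k ≫ W.hom = (V k).hom := Over.w ((Scheme.ProEt.forget X).map (v k))
    have hl : vl l ≫ W.hom = (V l).hom := Over.w ((Scheme.ProEt.forget X).map (v l))
    have hzb : pullback.snd (vl k) (vl l) ≫ (V l).hom = pullback.fst (vl k) (vl l) ≫ (V k).hom :=
      (congrArg (pullback.snd (vl k) (vl l) ≫ ·) hl.symm).trans
        ((Category.assoc _ _ _).symm.trans ((congrArg (· ≫ W.hom) pullback.condition.symm).trans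
          ((Category.assoc _ _ _).trans (congrArg (pullback.fst (vl k) (vl l) ≫ ·) hk))))
    let zb : Zs ⟶ V l := MorphismProperty.Over.homMk (pullback.snd (vl k) (vl l)) hzb
    have hzab : za ≫ v k = zb ≫ v l := MorphismProperty.Over.Hom.ext pullback.condition
    have hsub := hOcont k l Zs za zb (M ≫ θ) hzab hMθ₁ hMθ₂
    -- conclude
    have h1 : pullback.snd πᵢ (q k l) x = θ (ψ x) := congrArg (fun φ => φ x) hψθ.symm
    rw [Set.mem_preimage, h1, ← hc]
    exact hsub ⟨c, rfl⟩
  -- the tube lemma, for each pair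
  have htube : ∀ k l, ∃ (C₁ : Set (P k)) (C₂ : Set (P l)), (IsOpen C₁ ∧ IsCompact C₁) ∧
      Set.range (mP k) ⊆ C₁ ∧ (IsOpen C₂ ∧ IsCompact C₂) ∧ Set.range (mP l) ⊆ C₂ ∧
      p₁ k l ⁻¹' C₁ ∩ p₂ k l ⁻¹' C₂ ⊆ pullback.snd πᵢ (q k l) ⁻¹' (O k l : Set (Q k l)) := by
    intro k l
    exact exists_isOpen_isCompact_preimage_inter_preimage_subset (p₁ k l).continuous
      (p₂ k l).continuous
      (fun U hU hU' => QuasiCompact.isCompact_preimage (f := p₁ k l) U hU hU')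
      (fun U hU hU' => QuasiCompact.isCompact_preimage (f := p₂ k l) U hU hU')
      (Set.range (mP k)) (Set.range (mP l)) (hsat k) (hsat l)
      ((O k l).isOpen.preimage (pullback.snd πᵢ (q k l)).continuous) (hH k l)
  choose C₁ C₂ hC₁ hIC₁ hC₂ hIC₂ hCC using htube
  -- one compact open `C' k` per `k`
  let C' : ∀ k, Set (P k) := fun k => ⋂ l ∈ (Finset.univ : Finset (Fin n)), (C₁ k l ∩ C₂ l k)
  have hC' : ∀ k, IsOpen (C' k) ∧ IsCompact (C' k) := fun k =>
    isOpen_isCompact_biInter_finset (fun l => C₁ k l ∩ C₂ l k) (fun l =>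
      ⟨(hC₁ k l).1.inter (hC₂ l k).1, QuasiSeparatedSpace.inter_isCompact _ _ (hC₁ k l).1
        (hC₁ k l).2 (hC₂ l k).1 (hC₂ l k).2⟩) Finset.univ
  have hIC' : ∀ k, Set.range (mP k) ⊆ C' k := fun k =>
    Set.subset_iInter₂ fun l _ => Set.subset_inter (hIC₁ k l) (hIC₂ l k)
  have hC'O : ∀ k l, p₁ k l ⁻¹' C' k ∩ p₂ k l ⁻¹' C' l ⊆
      pullback.snd πᵢ (q k l) ⁻¹' (O k l : Set (Q k l)) := by
    intro k l x hx
    refine hCC k l ⟨?_, ?_⟩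
    · exact ((Set.mem_iInter₂.1 hx.1) l (Finset.mem_univ l)).1
    · exact ((Set.mem_iInter₂.1 hx.2) k (Finset.mem_univ k)).2
  let C'o : ∀ k, (P k).Opens := fun k => ⟨C' k, (hC' k).1⟩
  /- ## Step 2: the limit presentations `P k = lim_j U_j ×_{U_i} T_k`,
    `PQ k l = lim_j U_j ×_{U_i} Q k l`, and descent of the `C' k` -/
  let D : 𝔭.ι ⥤ Scheme.{u} := (𝔭.diagram ⋙ Scheme.Etale.forget X) ⋙ Over.forget X
  let c : Cone D := (Over.forget X).mapCone 𝔭.overCone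
  have hc : IsLimit c := isLimitOfPreserves (Over.forget X) 𝔭.isLimitOverCone
  haveI hDaff : ∀ j, IsAffine (D.obj j) := fun j => 𝔭.isAffine j
  haveI hDaffmap : ∀ {j j' : 𝔭.ι} (f : j ⟶ j'), IsAffineHom (D.map f) := fun f => inferInstance
  haveI hDcpt : ∀ j, CompactSpace (D.obj j) := fun j => inferInstance
  let Dk : ∀ k, Over i ⥤ Scheme.{u} := fun k =>
    Over.post D ⋙ Over.pullback (tk k) ⋙ Over.forget _
  let ck : ∀ k, Cone (Dk k) := fun k =>
    (Over.pullback (tk k) ⋙ Over.forget _).mapCone ((Over.conePost D i).obj c)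
  have hck : ∀ k, IsLimit (ck k) := fun k =>
    (nonempty_isLimit_mapCone_conePost D c i (tk k) hc).some
  haveI hDkaff : ∀ k j, IsAffine ((Dk k).obj j) := fun k j =>
    inferInstanceAs (IsAffine (pullback (D.map j.hom) (tk k)))
  haveI hDkaffmap : ∀ k {j j' : Over i} (f : j ⟶ j'), IsAffineHom ((Dk k).map f) :=
    fun k _ _ f => inferInstance
  let Dkl : ∀ k l, Over i ⥤ Scheme.{u} := fun k l =>
    Over.post D ⋙ Over.pullback (q k l) ⋙ Over.forget _
  let ckl : ∀ k l, Cone (Dkl k l) := fun k l =>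
    (Over.pullback (q k l) ⋙ Over.forget _).mapCone ((Over.conePost D i).obj c)
  have hckl : ∀ k l, IsLimit (ckl k l) := fun k l =>
    (nonempty_isLimit_mapCone_conePost D c i (q k l) hc).some
  haveI hDklaff : ∀ k l j, IsAffine ((Dkl k l).obj j) := fun k l j =>
    inferInstanceAs (IsAffine (pullback (D.map j.hom) (q k l)))
  haveI hDklaffmap : ∀ k l {j j' : Over i} (f : j ⟶ j'), IsAffineHom ((Dkl k l).map f) :=
    fun k l _ _ f => inferInstance
  -- descend the compact opens `C' k`
  have hdesc : ∀ k, ∃ (j : Over i) (Cj : ((Dk k).obj j).Opens),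
      IsCompact (Cj : Set ((Dk k).obj j)) ∧ (ck k).π.app j ⁻¹ᵁ Cj = C'o k := fun k =>
    exists_preimage_eq (Dk k) (ck k) (hck k) (C'o k) (hC' k).2
  choose jk Ck hCkc hCk using hdesc
  obtain ⟨j₀, hj₀⟩ := IsCofiltered.inf_objs_exists (Finset.univ.image jk)
  have hfk : ∀ k, Nonempty (j₀ ⟶ jk k) := fun k =>
    hj₀ (Finset.mem_image_of_mem jk (Finset.mem_univ k))
  let fk : ∀ k, j₀ ⟶ jk k := fun k => (hfk k).some
  let Ck₀ : ∀ k, ((Dk k).obj j₀).Opens := fun k => (Dk k).map (fk k) ⁻¹ᵁ Ck k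
  have hCk₀c : ∀ k, IsCompact (Ck₀ k : Set ((Dk k).obj j₀)) := fun k =>
    ((Dk k).map (fk k)).isCompact_preimage (hCkc k)
  have hCk₀ : ∀ k, (ck k).π.app j₀ ⁻¹ᵁ Ck₀ k = C'o k := fun k =>
    (congrArg (fun m => m ⁻¹ᵁ Ck k) ((ck k).w (fk k))).trans (hCk k)
  /- ## Step 3: descend the containments `C' k ×_W C' l ⊆ O k l` -/
  have e₃ : ∀ j : Over i, D.map j.hom ≫ 𝟙 (D.obj i) = 𝟙 _ ≫ D.map j.hom := fun j => by simp
  let prj₁ : ∀ k l (j : Over i), (Dkl k l).obj j ⟶ (Dk k).obj j := fun k l j =>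
    pullback.map (D.map j.hom) (q k l) (D.map j.hom) (tk k) (𝟙 _) (pullback.fst _ _) (𝟙 _)
      (e₃ j) (e₁ k l)
  let prj₂ : ∀ k l (j : Over i), (Dkl k l).obj j ⟶ (Dk l).obj j := fun k l j =>
    pullback.map (D.map j.hom) (q k l) (D.map j.hom) (tk l) (𝟙 _) (pullback.snd _ _) (𝟙 _)
      (e₃ j) (e₂ k l)
  let Uo : ∀ k l, ((Dkl k l).obj j₀).Opens := fun k l =>
    prj₁ k l j₀ ⁻¹ᵁ Ck₀ k ⊓ prj₂ k l j₀ ⁻¹ᵁ Ck₀ l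
  let Vo : ∀ k l, ((Dkl k l).obj j₀).Opens := fun k l =>
    pullback.snd (D.map j₀.hom) (q k l) ⁻¹ᵁ O k l
  have hUoc : ∀ k l, IsCompact (Uo k l : Set ((Dkl k l).obj j₀)) := fun k l =>
    QuasiSeparatedSpace.inter_isCompact _ _ (prj₁ k l j₀ ⁻¹ᵁ Ck₀ k).isOpen
      ((prj₁ k l j₀).isCompact_preimage (hCk₀c k)) (prj₂ k l j₀ ⁻¹ᵁ Ck₀ l).isOpen
      ((prj₂ k l j₀).isCompact_preimage (hCk₀c l))
  -- compatibility of the projections with the cone maps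
  have hprj₁ : ∀ k l (j : Over i), (ckl k l).π.app j ≫ prj₁ k l j = p₁ k l ≫ (ck k).π.app j := by
    intro k l j
    refine pullback.hom_ext ?_ ?_
    · exact (Category.assoc _ _ _).trans ((congrArg ((ckl k l).π.app j ≫ ·)
        (pullback.lift_fst _ _ _)).trans ((Category.assoc _ _ _).symm.trans
        ((Category.comp_id _).trans ((mapCone_conePost_π_app_fst D c i (q k l) j).trans
        ((congrArg (· ≫ c.π.app j.left) (Category.comp_id _)).symm.trans
        ((congrArg (· ≫ c.π.app j.left) (pullback.lift_fst _ _ _)).symm.trans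
        ((Category.assoc _ _ _).trans ((congrArg (p₁ k l ≫ ·)
          (mapCone_conePost_π_app_fst D c i (tk k) j)).symm.trans
          (Category.assoc _ _ _).symm))))))))
    · exact (Category.assoc _ _ _).trans ((congrArg ((ckl k l).π.app j ≫ ·)
        (pullback.lift_snd _ _ _)).trans ((Category.assoc _ _ _).symm.trans
        ((congrArg (· ≫ pullback.fst (tk k) (tk l)) (mapCone_conePost_π_app_snd D c i (q k l) j)).trans
        ((pullback.lift_snd _ _ _).symm.trans ((congrArg (p₁ k l ≫ ·)
          (mapCone_conePost_π_app_snd D c i (tk k) j)).symm.trans (Category.assoc _ _ _).symm)))))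
  have hprj₂ : ∀ k l (j : Over i), (ckl k l).π.app j ≫ prj₂ k l j = p₂ k l ≫ (ck l).π.app j := by
    intro k l j
    refine pullback.hom_ext ?_ ?_
    · exact (Category.assoc _ _ _).trans ((congrArg ((ckl k l).π.app j ≫ ·)
        (pullback.lift_fst _ _ _)).trans ((Category.assoc _ _ _).symm.trans
        ((Category.comp_id _).trans ((mapCone_conePost_π_app_fst D c i (q k l) j).trans
        ((congrArg (· ≫ c.π.app j.left) (Category.comp_id _)).symm.trans
        ((congrArg (· ≫ c.π.app j.left) (pullback.lift_fst _ _ _)).symm.trans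
        ((Category.assoc _ _ _).trans ((congrArg (p₂ k l ≫ ·)
          (mapCone_conePost_π_app_fst D c i (tk l) j)).symm.trans
          (Category.assoc _ _ _).symm))))))))
    · exact (Category.assoc _ _ _).trans ((congrArg ((ckl k l).π.app j ≫ ·)
        (pullback.lift_snd _ _ _)).trans ((Category.assoc _ _ _).symm.trans
        ((congrArg (· ≫ pullback.snd (tk k) (tk l)) (mapCone_conePost_π_app_snd D c i (q k l) j)).trans
        ((pullback.lift_snd _ _ _).symm.trans ((congrArg (p₂ k l ≫ ·)
          (mapCone_conePost_π_app_snd D c i (tk l) j)).symm.trans (Category.assoc _ _ _).symm)))))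
  have hUV : ∀ k l, (ckl k l).π.app j₀ ⁻¹ᵁ Uo k l ≤ (ckl k l).π.app j₀ ⁻¹ᵁ Vo k l := by
    intro k l x hx
    have hx₁ : prj₁ k l j₀ ((ckl k l).π.app j₀ x) ∈ Ck₀ k := hx.1
    have hx₂ : prj₂ k l j₀ ((ckl k l).π.app j₀ x) ∈ Ck₀ l := hx.2
    rw [← Scheme.Hom.comp_apply, hprj₁] at hx₁
    rw [← Scheme.Hom.comp_apply, hprj₂] at hx₂
    have hy₁ : p₁ k l x ∈ C' k := by
      have : p₁ k l x ∈ ((ck k).π.app j₀ ⁻¹ᵁ Ck₀ k) := hx₁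
      rwa [hCk₀ k] at this
    have hy₂ : p₂ k l x ∈ C' l := by
      have : p₂ k l x ∈ ((ck l).π.app j₀ ⁻¹ᵁ Ck₀ l) := hx₂
      rwa [hCk₀ l] at this
    have hz := hC'O k l ⟨hy₁, hy₂⟩
    rw [Set.mem_preimage] at hz
    have e := congrArg (fun φ => φ x) (mapCone_conePost_π_app_snd D c i (q k l) j₀)
    exact (congrArg (fun y => y ∈ (O k l : Set (Q k l))) e).mpr hz
  -- descend, pair after pair
  have hind : ∀ s : Finset (Fin n × Fin n), ∃ (j : Over i) (ψ : j ⟶ j₀), ∀ kl ∈ s,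
      (Dkl kl.1 kl.2).map ψ ⁻¹ᵁ Uo kl.1 kl.2 ≤ (Dkl kl.1 kl.2).map ψ ⁻¹ᵁ Vo kl.1 kl.2 := by
    intro s
    induction s using Finset.induction_on with
    | empty => exact ⟨j₀, 𝟙 j₀, fun kl hkl => absurd hkl (Finset.notMem_empty kl)⟩
    | insert kl s hkl ih =>
      obtain ⟨j, ψ, hψ⟩ := ih
      obtain ⟨k, l⟩ := kl
      have H : (ckl k l).π.app j ⁻¹ᵁ ((Dkl k l).map ψ ⁻¹ᵁ Uo k l) ≤
          (ckl k l).π.app j ⁻¹ᵁ ((Dkl k l).map ψ ⁻¹ᵁ Vo k l) := by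
        have e₁ := congrArg (fun m => m ⁻¹ᵁ Uo k l) ((ckl k l).w ψ)
        have e₂ := congrArg (fun m => m ⁻¹ᵁ Vo k l) ((ckl k l).w ψ)
        exact fun x hx => (e₂.symm.le) (hUV k l (e₁.le hx))
      obtain ⟨j', f, hf⟩ := exists_map_preimage_le_map_preimage (Dkl k l) (ckl k l) (hckl k l)
        (((Dkl k l).map ψ).isCompact_preimage (hUoc k l)) H
      refine ⟨j', f ≫ ψ, fun kl' hkl' => ?_⟩
      rw [Functor.map_comp, Scheme.Hom.comp_preimage, Scheme.Hom.comp_preimage]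
      rcases Finset.mem_insert.1 hkl' with rfl | hmem
      · exact hf
      · exact fun x hx => hψ kl' hmem hx
  obtain ⟨j₁, ψ₁, hψ₁⟩ := hind Finset.univ
  /- ## Step 4: the level `j₁`; descend the joint surjectivity -/
  let CkS : ∀ k, ((Dk k).obj j₁).Opens := fun k => (Dk k).map ψ₁ ⁻¹ᵁ Ck₀ k
  have hCkS : ∀ k, (ck k).π.app j₁ ⁻¹ᵁ CkS k = C'o k := fun k =>
    (congrArg (fun m => m ⁻¹ᵁ Ck₀ k) ((ck k).w ψ₁)).trans (hCk₀ k)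
  have hmem : ∀ k (x : (V k).left), (ck k).π.app j₁ (mP k x) ∈ CkS k := fun k x => by
    have : mP k x ∈ C'o k := hIC' k ⟨x, rfl⟩
    rw [← hCkS k] at this
    exact this
  -- the étale maps `CkS k → U_{j₁}`
  let fE : ∀ k, (Dk k).obj j₁ ⟶ D.obj j₁.left := fun k =>
    pullback.fst ((Over.post D).obj j₁).hom (tk k)
  let sE : ∀ k, (Dk k).obj j₁ ⟶ (T k).left := fun k =>
    pullback.snd ((Over.post D).obj j₁).hom (tk k)
  have hfEet : ∀ k, Etale (fE k) := fun k => MorphismProperty.pullback_fst _ _ (htk k)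
  let ock : ∀ k, ((CkS k : Scheme.{u})) ⟶ D.obj j₁.left := fun k => (CkS k).ι ≫ fE k
  have hocket : ∀ k, Etale (ock k) := fun k =>
    @Etale.etale_comp _ _ _ _ _ inferInstance (hfEet k)
  have hockopen : ∀ k, IsOpen (Set.range (ock k)) := fun k => by
    haveI := hocket k
    exact (ock k).isOpenMap.isOpen_range
  let Ω : (D.obj j₁.left).Opens := ⨆ k, ⟨Set.range (ock k), hockopen k⟩
  have hΩ : c.π.app j₁.left ⁻¹ᵁ Ω = ⊤ := by
    refine top_le_iff.1 fun w _ => ?_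
    obtain ⟨k, x, rfl⟩ := hcov w
    refine TopologicalSpace.Opens.mem_iSup.2 ⟨k, ⟨(ck k).π.app j₁ (mP k x), hmem k x⟩, ?_⟩
    have e := congrArg (fun φ => φ (mP k x)) (mapCone_conePost_π_app_fst D c i (tk k) j₁)
    have e' := congrArg (fun φ => φ x) (pullback.lift_fst (vl k) (gl k) (hmP k))
    exact e.trans (congrArg (c.π.app j₁.left) e')
  obtain ⟨j₂, f₂, hf₂⟩ := exists_map_eq_top D c hc Ω hΩ
  /- ## Step 5: the final objects `T' k := U_{j₂} ×_{U_{j₁}} CkS k` -/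
  let dm : D.obj j₂ ⟶ D.obj j₁.left := D.map f₂
  have hT'et : ∀ k, Etale (pullback.fst dm (ock k) ≫ (𝔭.diagram.obj j₂).hom) := fun k =>
    @Etale.etale_comp _ _ _ _ _ (MorphismProperty.pullback_fst _ _ (hocket k))
      (𝔭.diagram.obj j₂).prop
  let T' : Fin n → X.Etale := fun k =>
    MorphismProperty.Over.mk ⊤ (pullback.fst dm (ock k) ≫ (𝔭.diagram.obj j₂).hom) (hT'et k)
  let τ' : ∀ k, T' k ⟶ 𝔭.diagram.obj j₂ := fun k =>
    MorphismProperty.Over.homMk (pullback.fst dm (ock k)) rfl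
  -- `ρ k : T' k → T k`
  let ρl : ∀ k, (T' k).left ⟶ (T k).left := fun k => pullback.snd dm (ock k) ≫ (CkS k).ι ≫ sE k
  have hUj₁ : D.map j₁.hom ≫ U.hom = (𝔭.diagram.obj j₁.left).hom :=
    Over.w ((Scheme.Etale.forget X).map (𝔭.diagram.map j₁.hom))
  have hUj₂ : dm ≫ (𝔭.diagram.obj j₁.left).hom = (𝔭.diagram.obj j₂).hom :=
    Over.w ((Scheme.Etale.forget X).map (𝔭.diagram.map f₂))
  have hTk : ∀ k, tk k ≫ U.hom = (T k).hom := fun k =>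
    Over.w ((Scheme.Etale.forget X).map (τ k))
  have hρτl : ∀ k, ρl k ≫ tk k = pullback.fst dm (ock k) ≫ (dm ≫ D.map j₁.hom) := by
    intro k
    have c1 : pullback.fst dm (ock k) ≫ dm = pullback.snd dm (ock k) ≫ ((CkS k).ι ≫ fE k) :=
      pullback.condition
    have c2 : fE k ≫ D.map j₁.hom = sE k ≫ tk k := pullback.condition
    exact (Category.assoc _ _ _).trans
      ((congrArg (pullback.snd dm (ock k) ≫ ·) ((Category.assoc _ _ _).trans
        (congrArg ((CkS k).ι ≫ ·) c2.symm))).trans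
      ((congrArg (pullback.snd dm (ock k) ≫ ·) (Category.assoc _ _ _).symm).trans
      ((Category.assoc _ _ _).symm.trans
      ((congrArg (· ≫ D.map j₁.hom) c1.symm).trans (Category.assoc _ _ _)))))
  have hρ : ∀ k, ρl k ≫ (T k).hom = (T' k).hom := fun k =>
    (congrArg (ρl k ≫ ·) (hTk k).symm).trans ((Category.assoc _ _ _).symm.trans
      ((congrArg (· ≫ U.hom) (hρτl k)).trans ((Category.assoc _ _ _).trans
      ((congrArg (pullback.fst dm (ock k) ≫ ·) (Category.assoc _ _ _)).trans
      ((congrArg (fun x => pullback.fst dm (ock k) ≫ (dm ≫ x)) hUj₁).trans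
      (congrArg (pullback.fst dm (ock k) ≫ ·) hUj₂))))))
  let ρ : ∀ k, T' k ⟶ T k := fun k => MorphismProperty.Over.homMk (ρl k) (hρ k)
  have hρτ : ∀ k, ρ k ≫ τ k = τ' k ≫ 𝔭.diagram.map (f₂ ≫ j₁.hom) :=
    fun k => MorphismProperty.Over.Hom.ext ((hρτl k).trans (congrArg (pullback.fst dm (ock k) ≫ ·)
      (D.map_comp f₂ j₁.hom).symm))
  -- `g' k : V k → T' k`
  have hlamr : ∀ k, Set.range (mP k ≫ (ck k).π.app j₁) ⊆ Set.range (CkS k).ι := by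
    rintro k _ ⟨x, rfl⟩
    rw [Scheme.Opens.range_ι]
    exact hmem k x
  let lam : ∀ k, (V k).left ⟶ (CkS k : Scheme.{u}) := fun k =>
    IsOpenImmersion.lift (CkS k).ι (mP k ≫ (ck k).π.app j₁) (hlamr k)
  have hlam : ∀ k, lam k ≫ (CkS k).ι = mP k ≫ (ck k).π.app j₁ := fun k =>
    IsOpenImmersion.lift_fac _ _ _
  let vπ : ∀ k, (V k).left ⟶ D.obj j₂ := fun k => (v k ≫ 𝔭.π.app j₂).left
  have hvπ : ∀ k, vπ k ≫ dm = lam k ≫ ock k := by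
    intro k
    have h1 : vπ k ≫ dm = vl k ≫ c.π.app j₁.left :=
      congrArg (fun φ : V k ⟶ E.obj (𝔭.diagram.obj j₁.left) => φ.left)
        ((Category.assoc (v k) (𝔭.π.app j₂) (E.map (𝔭.diagram.map f₂))).trans
          (congrArg (v k ≫ ·) (𝔭.π_comp f₂)))
    have h2 : lam k ≫ ock k = vl k ≫ c.π.app j₁.left :=
      (Category.assoc _ _ _).symm.trans ((congrArg (· ≫ fE k) (hlam k)).trans
        ((Category.assoc _ _ _).trans ((congrArg (mP k ≫ ·)
          (mapCone_conePost_π_app_fst D c i (tk k) j₁)).trans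
          ((Category.assoc _ _ _).symm.trans (congrArg (· ≫ c.π.app j₁.left)
            (pullback.lift_fst _ _ _))))))
    exact h1.trans h2.symm
  let g'l : ∀ k, (V k).left ⟶ (T' k).left := fun k => pullback.lift (vπ k) (lam k) (hvπ k)
  have hg'l : ∀ k, g'l k ≫ (T' k).hom = (V k).hom := fun k =>
    ((Category.assoc _ _ _).symm.trans (congrArg (· ≫ (𝔭.diagram.obj j₂).hom)
      (pullback.lift_fst _ _ _))).trans (Over.w ((Scheme.ProEt.forget X).map (v k ≫ 𝔭.π.app j₂)))
  let g' : ∀ k, V k ⟶ E.obj (T' k) := fun k => MorphismProperty.Over.homMk (g'l k) (hg'l k)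
  /- ## the four properties -/
  refine ⟨j₂, T', τ', ρ, g', fun k => ?_, fun k => ?_, fun x => ?_, fun k l Z a b hab => ?_⟩
  · -- `g' k ≫ ρ k = g k`
    refine MorphismProperty.Over.Hom.ext ?_
    change g'l k ≫ (pullback.snd dm (ock k) ≫ (CkS k).ι ≫ sE k) = gl k
    exact (Category.assoc _ _ _).symm.trans ((congrArg (· ≫ ((CkS k).ι ≫ sE k))
      (pullback.lift_snd _ _ _)).trans ((Category.assoc _ _ _).symm.trans
      ((congrArg (· ≫ sE k) (hlam k)).trans ((Category.assoc _ _ _).trans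
      ((congrArg (mP k ≫ ·) (mapCone_conePost_π_app_snd D c i (tk k) j₁)).trans
        (pullback.lift_snd _ _ _))))))
  · -- `g' k ≫ τ' k = v k ≫ π_{j₂}`
    exact MorphismProperty.Over.Hom.ext (pullback.lift_fst _ _ _)
  · -- joint surjectivity
    have hx : dm x ∈ Ω := by
      have : x ∈ dm ⁻¹ᵁ Ω := by rw [hf₂]; trivial
      exact this
    obtain ⟨k, hk⟩ := TopologicalSpace.Opens.mem_iSup.1 hx
    obtain ⟨y, hy⟩ := hk
    obtain ⟨z, hz, -⟩ := Scheme.Pullback.exists_preimage_pullback (f := dm) (g := ock k) x y hy.symm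
    exact ⟨k, z, hz⟩
  · -- agreement: reduce to `hOagree` via `m : Z → Q k l`
    have hdd : (a ≫ ρ k) ≫ τ k = (b ≫ ρ l) ≫ τ l :=
      (Category.assoc _ _ _).trans ((congrArg (a ≫ ·) (hρτ k)).trans
        ((Category.assoc _ _ _).symm.trans ((congrArg (· ≫ 𝔭.diagram.map (f₂ ≫ j₁.hom)) hab).trans
        ((Category.assoc _ _ _).trans ((congrArg (b ≫ ·) (hρτ l)).symm.trans
          (Category.assoc _ _ _).symm)))))
    have hm : (a ≫ ρ k).left ≫ tk k = (b ≫ ρ l).left ≫ tk l :=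
      congrArg (fun φ : Z ⟶ U => φ.left) hdd
    let m : Z.left ⟶ Q k l := pullback.lift (a ≫ ρ k).left (b ≫ ρ l).left hm
    refine hOagree k l Z (a ≫ ρ k) (b ≫ ρ l) m (pullback.lift_fst _ _ _) (pullback.lift_snd _ _ _) ?_
    rintro _ ⟨z, rfl⟩
    -- `Ξ : Z → U_{j₁} ×_{U_i} Q k l`
    have hab' : a.left ≫ pullback.fst dm (ock k) = b.left ≫ pullback.fst dm (ock l) :=
      congrArg (fun φ : Z ⟶ 𝔭.diagram.obj j₂ => φ.left) hab
    have hΞ : (a.left ≫ pullback.fst dm (ock k) ≫ dm) ≫ ((Over.post D).obj j₁).hom = m ≫ q k l :=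
      (Category.assoc _ _ _).trans ((congrArg (a.left ≫ ·) ((Category.assoc _ _ _).trans
        (hρτl k).symm)).trans ((Category.assoc _ _ _).symm.trans
        ((congrArg (· ≫ tk k) (pullback.lift_fst _ _ hm).symm).trans (Category.assoc _ _ _))))
    let Ξ : Z.left ⟶ (Dkl k l).obj j₁ := pullback.lift (a.left ≫ pullback.fst dm (ock k) ≫ dm) m hΞ
    have hΞ₁ : Ξ ≫ prj₁ k l j₁ = a.left ≫ pullback.snd dm (ock k) ≫ (CkS k).ι := by
      refine pullback.hom_ext ?_ ?_
      · exact (Category.assoc _ _ _).trans ((congrArg (Ξ ≫ ·) (pullback.lift_fst _ _ _)).trans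
          ((Category.assoc _ _ _).symm.trans ((Category.comp_id _).trans
          ((pullback.lift_fst _ _ hΞ).trans ((congrArg (a.left ≫ ·)
            (pullback.condition (f := dm) (g := ock k))).trans
          ((congrArg (a.left ≫ ·) (Category.assoc _ _ _).symm).trans
            (Category.assoc _ _ _).symm))))))
      · exact (Category.assoc _ _ _).trans ((congrArg (Ξ ≫ ·) (pullback.lift_snd _ _ _)).trans
          ((Category.assoc _ _ _).symm.trans ((congrArg (· ≫ pullback.fst (tk k) (tk l))
            (pullback.lift_snd _ _ hΞ)).trans ((pullback.lift_fst _ _ hm).trans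
            ((congrArg (a.left ≫ ·) (Category.assoc _ _ _).symm).trans
              (Category.assoc _ _ _).symm)))))
    have hΞ₂ : Ξ ≫ prj₂ k l j₁ = b.left ≫ pullback.snd dm (ock l) ≫ (CkS l).ι := by
      refine pullback.hom_ext ?_ ?_
      · exact (Category.assoc _ _ _).trans ((congrArg (Ξ ≫ ·) (pullback.lift_fst _ _ _)).trans
          ((Category.assoc _ _ _).symm.trans ((Category.comp_id _).trans
          ((pullback.lift_fst _ _ hΞ).trans (((Category.assoc _ _ _).symm.trans
            (congrArg (· ≫ dm) hab')).trans ((Category.assoc _ _ _).trans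
          ((congrArg (b.left ≫ ·) (pullback.condition (f := dm) (g := ock l))).trans
          ((congrArg (b.left ≫ ·) (Category.assoc _ _ _).symm).trans
            (Category.assoc _ _ _).symm))))))))
      · exact (Category.assoc _ _ _).trans ((congrArg (Ξ ≫ ·) (pullback.lift_snd _ _ _)).trans
          ((Category.assoc _ _ _).symm.trans ((congrArg (· ≫ pullback.snd (tk k) (tk l))
            (pullback.lift_snd _ _ hΞ)).trans ((pullback.lift_snd _ _ hm).trans
            ((congrArg (b.left ≫ ·) (Category.assoc _ _ _).symm).trans
              (Category.assoc _ _ _).symm)))))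
    -- naturality of `prj` in `j`
    have nat₁ : (Dkl k l).map ψ₁ ≫ prj₁ k l j₀ = prj₁ k l j₁ ≫ (Dk k).map ψ₁ := by
      refine pullback.hom_ext ?_ ?_
      · exact (Category.assoc _ _ _).trans ((congrArg ((Dkl k l).map ψ₁ ≫ ·)
          (pullback.lift_fst _ _ _)).trans ((Category.assoc _ _ _).symm.trans
          ((Category.comp_id _).trans ((post_pullback_forget_map_fst D i (q k l) ψ₁).trans
          ((congrArg (· ≫ D.map ψ₁.left) (Category.comp_id _)).symm.trans
          ((congrArg (· ≫ D.map ψ₁.left) (pullback.lift_fst _ _ _)).symm.trans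
          ((Category.assoc _ _ _).trans ((congrArg (prj₁ k l j₁ ≫ ·)
            (post_pullback_forget_map_fst D i (tk k) ψ₁)).symm.trans
            (Category.assoc _ _ _).symm))))))))
      · exact (Category.assoc _ _ _).trans ((congrArg ((Dkl k l).map ψ₁ ≫ ·)
          (pullback.lift_snd _ _ _)).trans ((Category.assoc _ _ _).symm.trans
          ((congrArg (· ≫ pullback.fst (tk k) (tk l)) (post_pullback_forget_map_snd D i (q k l) ψ₁)).trans
          ((pullback.lift_snd _ _ _).symm.trans ((congrArg (prj₁ k l j₁ ≫ ·)
            (post_pullback_forget_map_snd D i (tk k) ψ₁)).symm.trans (Category.assoc _ _ _).symm)))))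
    have nat₂ : (Dkl k l).map ψ₁ ≫ prj₂ k l j₀ = prj₂ k l j₁ ≫ (Dk l).map ψ₁ := by
      refine pullback.hom_ext ?_ ?_
      · exact (Category.assoc _ _ _).trans ((congrArg ((Dkl k l).map ψ₁ ≫ ·)
          (pullback.lift_fst _ _ _)).trans ((Category.assoc _ _ _).symm.trans
          ((Category.comp_id _).trans ((post_pullback_forget_map_fst D i (q k l) ψ₁).trans
          ((congrArg (· ≫ D.map ψ₁.left) (Category.comp_id _)).symm.trans
          ((congrArg (· ≫ D.map ψ₁.left) (pullback.lift_fst _ _ _)).symm.trans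
          ((Category.assoc _ _ _).trans ((congrArg (prj₂ k l j₁ ≫ ·)
            (post_pullback_forget_map_fst D i (tk l) ψ₁)).symm.trans
            (Category.assoc _ _ _).symm))))))))
      · exact (Category.assoc _ _ _).trans ((congrArg ((Dkl k l).map ψ₁ ≫ ·)
          (pullback.lift_snd _ _ _)).trans ((Category.assoc _ _ _).symm.trans
          ((congrArg (· ≫ pullback.snd (tk k) (tk l)) (post_pullback_forget_map_snd D i (q k l) ψ₁)).trans
          ((pullback.lift_snd _ _ _).symm.trans ((congrArg (prj₂ k l j₁ ≫ ·)
            (post_pullback_forget_map_snd D i (tk l) ψ₁)).symm.trans (Category.assoc _ _ _).symm)))))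
    -- `Ξ z` lands in `Uo` after `ψ₁`, hence in `Vo`
    have hU : (Dkl k l).map ψ₁ (Ξ z) ∈ Uo k l := by
      constructor
      · change prj₁ k l j₀ ((Dkl k l).map ψ₁ (Ξ z)) ∈ Ck₀ k
        have e := congrArg (fun φ => φ (Ξ z)) nat₁
        have e' := congrArg (fun φ => φ z) hΞ₁
        refine (congrArg (· ∈ (Ck₀ k : Set ((Dk k).obj j₀))) e).mpr ?_
        change prj₁ k l j₁ (Ξ z) ∈ CkS k
        refine (congrArg (· ∈ (CkS k : Set ((Dk k).obj j₁))) e').mpr ?_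
        exact (pullback.snd dm (ock k) (a.left z)).2
      · change prj₂ k l j₀ ((Dkl k l).map ψ₁ (Ξ z)) ∈ Ck₀ l
        have e := congrArg (fun φ => φ (Ξ z)) nat₂
        have e' := congrArg (fun φ => φ z) hΞ₂
        refine (congrArg (· ∈ (Ck₀ l : Set ((Dk l).obj j₀))) e).mpr ?_
        change prj₂ k l j₁ (Ξ z) ∈ CkS l
        refine (congrArg (· ∈ (CkS l : Set ((Dk l).obj j₁))) e').mpr ?_
        exact (pullback.snd dm (ock l) (b.left z)).2
    have hV : (Dkl k l).map ψ₁ (Ξ z) ∈ Vo k l := hψ₁ (k, l) (Finset.mem_univ _) hU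
    change pullback.snd (D.map j₀.hom) (q k l) ((Dkl k l).map ψ₁ (Ξ z)) ∈ O k l at hV
    have e1 := congrArg (fun φ => φ (Ξ z)) (post_pullback_forget_map_snd D i (q k l) ψ₁)
    have e2 := congrArg (fun φ => φ z) (pullback.lift_snd _ _ hΞ)
    exact (congrArg (· ∈ (O k l : Set (Q k l))) e2).mp
      ((congrArg (· ∈ (O k l : Set (Q k l))) e1).mp hV)

end Descent

/-! ### The surjectivity half, and the discharge of Lemma 5.1.1 / 5.1.2 -/

section Final

variable {X : Scheme.{u}} {W : X.ProEt}

/-- **The surjectivity half of Bhatt–Scholze Lemma 5.1.1, proved unconditionally**: for a pro-étale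
affine `W = lim_i U_i` and an abelian étale sheaf `F`, every `t ∈ ν*F(W) = (Lan F)^#(W)` is the
class of a section of some `F(U_j)`. Assembly of the previous steps: local lifts on a finite affine
cover (`exists_local_lifts_affine`), agreement near the image on overlaps
(`exists_opens_forall_map_eq`), the tube lemma over `W` and descent to some `U_j`
(`exists_descended_data`), gluing in `F` (`exists_map_eq_of_arrows_compatible`) and the check on
the cover (`toSheafify_lanCocone_ι_app_eq`). No use of Lemma 4.2.4 / Thm. 2.3.4.
[cite: BhattScholze2015, Lemma 5.1.1] -/
theorem ProetAffinePresentation.surjective_toSheafify_lan_app (𝔭 : ProetAffinePresentation X W)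
    (F : Sheaf X.smallEtaleTopology Ab.{u + 1}) :
    Function.Surjective ((toSheafify (Scheme.ProEt.topology X)
      ((etaleToProet X).op.lan.obj F.obj)).app (op W)) := by
  intro t
  let P := (etaleToProet X).op.lan.obj F.obj
  obtain ⟨i⟩ := IsCofiltered.nonempty (C := 𝔭.ι)
  obtain ⟨n, V, v, T, τ, g, s', hVaff, hTaff, hcov, hcomm, hlift⟩ :=
    𝔭.exists_local_lifts_affine F t i
  have hO := fun k l => 𝔭.exists_opens_forall_map_eq F t i V v T τ g hcomm s' hlift k l
  obtain ⟨j, T', τ', ρ, g', hρ, hτ', hsurj, hagree⟩ :=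
    𝔭.exists_descended_data F i V v T τ g s' hVaff hTaff hcov hcomm hO
  -- glue the `s'_k|_{T'_k}` over `U_j`
  obtain ⟨s, hs⟩ := exists_map_eq_of_arrows_compatible F T' τ' hsurj
    (fun k => F.obj.map (ρ k).op (s' k)) fun k l Z a b hab =>
      (ConcreteCategory.congr_hom (F.obj.map_comp (ρ k).op a.op) (s' k)).symm.trans
        ((hagree k l Z a b hab).trans (ConcreteCategory.congr_hom (F.obj.map_comp (ρ l).op b.op) (s' l)))
  refine ⟨(𝔭.lanCocone F.obj).ι.app (op j) s, ?_⟩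
  haveI : ∀ k, IsAffine (V k).left := hVaff
  refine 𝔭.toSheafify_lanCocone_ι_app_eq F t j V v hcov T' τ' g' hτ'
    (fun k => F.obj.map (ρ k).op (s' k)) (fun k => ?_) s hs
  -- the new lifts still lift `t`
  have hnat : ((etaleToProet X).op.lanUnit.app F.obj).app (op (T' k)) (F.obj.map (ρ k).op (s' k)) =
      P.map ((etaleToProet X).map (ρ k)).op
        (((etaleToProet X).op.lanUnit.app F.obj).app (op (T k)) (s' k)) :=
    NatTrans.naturality_apply ((etaleToProet X).op.lanUnit.app F.obj) (ρ k).op (s' k)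
  refine Eq.trans ?_ (hlift k)
  apply congrArg ((toSheafify (Scheme.ProEt.topology X) P).app (op (V k)))
  rw [hnat]
  refine (ConcreteCategory.congr_hom (P.map_comp ((etaleToProet X).map (ρ k)).op (g' k).op)
    _).symm.trans ?_
  exact congrArg (fun ψ => P.map ψ.op (((etaleToProet X).op.lanUnit.app F.obj).app
    (op (T k)) (s' k))) (hρ k)

/-- **`(Lan F)(W) → ν*F(W)` is bijective** at every pro-étale affine `W`.
[cite: BhattScholze2015, Lemma 5.1.1] -/
theorem ProetAffinePresentation.bijective_toSheafify_lan_app (𝔭 : ProetAffinePresentation X W)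
    (F : Sheaf X.smallEtaleTopology Ab.{u + 1}) :
    Function.Bijective ((toSheafify (Scheme.ProEt.topology X)
      ((etaleToProet X).op.lan.obj F.obj)).app (op W)) :=
  ⟨𝔭.injective_toSheafify_lan_app F, 𝔭.surjective_toSheafify_lan_app F⟩

/-- **The sheafification map `(Lan F)(W) → (Lan F)^#(W) = ν*F(W)` is an isomorphism at every
pro-étale affine `W = lim_i U_i`.** [cite: BhattScholze2015, Lemma 5.1.1] -/
theorem ProetAffinePresentation.isIso_toSheafify_lan_app (𝔭 : ProetAffinePresentation X W)
    (F : Sheaf X.smallEtaleTopology Ab.{u + 1}) :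
    IsIso ((toSheafify (Scheme.ProEt.topology X) ((etaleToProet X).op.lan.obj F.obj)).app
      (op W)) :=
  (ConcreteCategory.isIso_iff_bijective _).2 (𝔭.bijective_toSheafify_lan_app F)

end Final

/-- **Discharge of the residual content of Bhatt–Scholze Lemma 5.1.1**
(`isIso_toSheafify_lan_app_of_presentation`, `EtaleToProetLan.lean`): on pro-étale affines the
presheaf inverse image `Lan F` of an abelian étale sheaf already has the values of the sheaf inverse
image `ν*F`. Proved directly on Mathlib's carriers, without the density of pro-étale affines
(Lemma 4.2.4 / Thm. 2.3.4): injectivity by `injective_toSheafify_lan_app`, surjectivity by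
`surjective_toSheafify_lan_app`. [cite: BhattScholze2015, Lemma 5.1.1] -/
theorem isIso_toSheafify_lan_app_of_presentation_holds :
    isIso_toSheafify_lan_app_of_presentation.{u} :=
  fun _ _ 𝔭 F => 𝔭.isIso_toSheafify_lan_app F

/-- **Bhatt–Scholze Lemma 5.1.1 holds on Mathlib's carriers**: for every presentation
`W = lim_i U_i` of a pro-étale affine and every abelian étale sheaf `F`, the canonical cocone
`F(U_i) → ν*F(W)` is a colimit, `ν*F(W) = colim_i F(U_i)` (discharge of the named fact
`nonempty_isColimit_sectionsCocone_etaleToProetPullback` of `EtaleToProetSections.lean`).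
[cite: BhattScholze2015, Lemma 5.1.1] -/
theorem nonempty_isColimit_sectionsCocone_etaleToProetPullback_holds :
    nonempty_isColimit_sectionsCocone_etaleToProetPullback.{u} :=
  nonempty_isColimit_sectionsCocone_etaleToProetPullback_of_toSheafify
    isIso_toSheafify_lan_app_of_presentation_holds

/-- **Bhatt–Scholze Lemma 5.1.2 holds on Mathlib's carriers: `ν* : Shv(X_ét, Ab) → Shv(X_proét, Ab)`
is fully faithful** (discharge of the named fact `full_faithful_etaleToProetPullback` of
`EtaleToProetExt.lean`, via Lemma 5.1.1). [cite: BhattScholze2015, Lemma 5.1.2] -/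
theorem full_faithful_etaleToProetPullback_holds : full_faithful_etaleToProetPullback.{u} :=
  full_faithful_etaleToProetPullback_of_toSheafify isIso_toSheafify_lan_app_of_presentation_holds

end Literature.AlgebraicGeometry.Motives

end
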